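import Literature.MathematicalPhysics.QuantumFieldTheory.Balaban1983to89.B3Eq14LamAllOrders
import Literature.MathematicalPhysics.QuantumFieldTheory.Balaban1983to89.HiggsFluctMeasureExpMoments

/-!
# `Balaban1983to89.B3Eq15ChargeDerivative` — T. Bałaban, *(Higgs)₂,₃ quantum fields in a finite volume. III.
Renormalization*, Commun. Math. Phys. **88** (1983) 411–445 [Balaban1983Higgs3], (1.3)–(1.5) p. 412 [PDF 2]:
**the `e′`-DERIVATIVE of the auxiliary function `E_k(e′, λ′, Ω, A^{(k)}, φ)` of (1.4) at fixed `λ′` EXISTS (two-sided,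
at every `e′₀`) and equals the normalized expectation of the CHARGE VERTEX; consequently the first-order repaired
interaction (1.5), `B3Eq15OneSidedInteraction.interaction15R D 1`, is the sum of two genuine expectations
`⟨charge vertex⟩₀ + ⟨λ′-vertex⟩₀`** (`interaction15R_one_eq_expectations`).  Companion of the typer's `B3Eq14Finite`
(§7–§10: the `λ′`-direction to order 2) and `B3Eq14LamAllOrders` (the `λ′`-direction to all orders), whose
`interaction15R_one_eq` left the `e′`-term of (1.5) as the symbol `deriv (fun e′ ↦ E_k(e′,0,…)) 0`; this file proves
that derivative exists and identifies it, in a separate module because `B3Eq14Finite` is at the gate's size limit.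

statement-level skeleton of published theorems with citation tags; proofs where landed; nothing here is a claim about
the Yang–Mills mass gap

THE ARGUMENT (ours; what the `α`-derivatives of the printed (1.5) presuppose to first order, for the typed instance
`Data14.auxE`).  The charge `e′` enters (1.4) only through the background field `e′g_kA′ + A^{(k)}`
(`Data14.extPieces`, `Data14.extField`), which is AFFINE in `e′`: the multiscale contour of (1.3) is
`(e′g_kA′ + A^{(k)})(Γ^{(k)}_{y,x}) = A^{(k)}(Γ^{(k)}_{y,x}) + e′·a_x(A′)` with `a_x(A′) = Σ_{j<k}(g_kA′^{(j),η})(Γ^{(j+1)})`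
(`fluctContour`, `contour13_extPieces`; contours (I.2.1)–(I.2.6) are additive and homogeneous in the field), and the
bond values are `A^{(k)}(b) + e′·G_b(A′)` (`fluctBond`, `extField_apply`); both coefficients are LINEAR in the
fluctuation family, hence `≤ C‖A′‖` (`exists_fluctContour_le`, `exists_fluctBond_le`).  So every factor of the fibre
integrand `t(Ω;φ,φ′)·exp[…](φ′)` of (1.4) is differentiable in `e′` with an explicit derivative: the transports
`U(𝒜(Γ)) = exp(qηe𝒜(Γ))` ((I.1.7); `d/ds U(a+sg)v = ηeg·qU(a+sg)v`) of the block averages `(Q(𝒜)φ′)(y)`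
(`hasDerivAt_holK13_apply`, `dAvgQ14`, `hasDerivAt_avgQ14_apply`), the Gaussian kernel
`t = Π_{y∈Ω^{(k)}}ρ_κ(φ(y) − (Q(𝒜)φ′)(y))` (`kernelVertex`, `hasDerivAt_kernel14`), the covariant derivatives of the
Dirichlet form of `−Δ^η_{𝒜,Ω}` (`dCovDeriv`, `hasDerivAt_covDeriv`, `dirichletVertex`,
`hasDerivAt_half_siteInner_scalarOp`) and the counterterms `δm²(e′,λ′,x)`, `E₁(e′,λ′)` (`densityVertex`,
`hasDerivAt_density14_charge`); altogether `∂_{e′}(t·exp[…]) = −(charge vertex)·t·exp[…]` with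
`charge vertex = kernelVertex + densityVertex` (`chargeVertex`, `hasDerivAt_fibre14_charge`).  Since `U` is an
isometry (`B1Ineq233Upper.norm_U_apply`), `|qw| ≤ |w|`, and a block average is `≤ L^{−kd}Σ_x|U(…)φ′(x)|`, the vertex
grows at most like `(K₀ + K₁‖A′‖)(1 + Σ_x|φ′(x)|²)²` (§3); with the Gaussian domination
`exp[…] ≤ e^{−E₁}e^{−2cΣ_x|φ′(x)|²}`, `c = m₀(L^kε)²η^d/4` (`B3Eq14Finite.density14_le_explicit`, renormalized mass
`≥ m₀ > 0` on `Ω₁` uniformly for `|e′ − e′₀| ≤ ρ`), the kernel bound `t ≤ Cκ` (`B3Eq14Finite.kernel14_le`) and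
`(1+S)²e^{−2cS} ≤ 2c⁻²e^{c}e^{−cS}`, this gives ONE majorant `(K₀ + K₁‖A′‖)·M·Π_{x∈Ω}e^{−c|φ′(x)|²}` of
`∂_{e′}(t·exp[…])` uniform in `e′ ∈ [e′₀−ρ, e′₀+ρ]` (`exists_chargeDeriv_majorant`), integrable against
`Π_j dμ_{C^{(j)}} ⊗ dφ′↾_Ω` by the FIRST MOMENT of the fluctuation family
(`HiggsFluctMeasureExpMoments.integrable_of_polyGrowth_fluctFamily`) times the Gaussian fibre
(`B3Eq14Finite.integrable_gauss_fibre`); dominated differentiation (Mathlib's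
`hasDerivAt_integral_of_dominated_loc_of_deriv_le`) of the single product integral
`B3Eq14Finite.integral_integrand14_eq_integral_prod` then differentiates `exp(−E_k)` and `E_k = −log(…)` in `e′`.

WHAT IS PROVED (theorems; eight `def`s — `fluctContour`, `fluctBond`, `dAvgQ14`, `kernelVertex`, `dCovDeriv`,
`dirichletVertex`, `densityVertex`, `chargeVertex` —, no `Prop` fact; axioms standard):
* §1 homogeneity of the contour sums `segSum_smul`, `contourSum_smul`, `multiContourSum_smul`, `etaSumK_smul`;
  `fluctContour`, **`contour13_extPieces`** (`𝒜(Γ^{(k)}_{·,x}) = A^{(k)}(Γ) + e′·a_x(A′)`), `fluctBond`,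
  **`extField_apply`**; linearity `fluctPiece_add/smul`, `fluctContour_add/smul`, `fluctBond_add/smul` and the linear
  growth bounds `exists_fluctContour_le`, `exists_fluctBond_le`;
* §2 `hasDerivAt_holK13_apply`, `dAvgQ14`, `hasDerivAt_avgQ14_apply`, `hasDerivAt_prod_rtKernel`, `kernelVertex`,
  **`hasDerivAt_kernel14`** (`∂_{e′}t = −kernelVertex·t`), `dCovDeriv`, `hasDerivAt_covDeriv`, `dirichletVertex`,
  `hasDerivAt_half_siteInner_scalarOp`, `densityVertex`, **`hasDerivAt_density14_charge`**
  (`∂_{e′}exp[…] = −densityVertex·exp[…]`), `chargeVertex`, **`hasDerivAt_fibre14_charge`**;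
* §3 `norm_holK13_apply`, `norm_q_apply_le`, `norm_avgQ14_le`, `norm_dAvgQ14_le`, `abs_kernelVertex_le`,
  `norm_covDeriv_le`, `norm_dCovDeriv_le`, `abs_dirichletVertex_le`, `abs_densityVertex_le`;
* §4 **`exists_chargeDeriv_majorant`** (one integrable majorant of `(charge vertex)·t·exp[…]`, uniform on
  `[e′₀−ρ, e′₀+ρ]`);
* §5 **`hasDerivAt_integral_integrand14_charge`** (`∂_{e′}∫Π_jdμ(A′)∫dφ′↾_Ω t·exp[…] = −∫∫(charge vertex)·t·exp[…]`,
  two-sided at `e′₀`), **`hasDerivAt_auxE_charge`** (`∂_{e′}E_k(e′₀,λ′,Ω,A^{(k)},φ) = ⟨charge vertex⟩_{e′₀}`, the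
  normalized expectation in `Z⁻¹·t·exp[…]dμ(A′)dφ′↾_Ω`), **`interaction15R_one_eq_expectations`**
  (`𝒫^{(k)}_{n̄=1} = ⟨charge vertex⟩₀ + ⟨λ′-vertex⟩₀`, both genuine derivatives: `B3Eq14Finite.interaction15R_one_eq`
  with its `∂_{e′}E_k(·,0)|₀` now proved to exist).
* v1.1 (documentation + build hygiene only; every declaration unchanged): the docstring of `chargeVertex` names the
  capstone `interaction15R_one_eq_expectations` correctly; `set_option maxHeartbeats 400000 in` on the private
  `abs_chargeDeriv_le` (measured at ≥ 90 % of the default budget by the build-hygiene lane).  Later companions: second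
  order in `e′` and the mixed term `B3Eq15ChargeSecondOrder`; joint `C^∞` in `(e′, λ′)` `B3Eq15JointSmooth`.
Hypotheses (H-charge): those of `B3Eq14Finite` §4 at the fixed `λ′` (`μ₀² > 0`, `a > 0`, `L > 1`, `k ≤ K` — and
`1 ≤ k` where `Z > 0` is used —, `L^kε ≠ 0`, `λ′λ(L^kε) ≥ 0`, `0 < m₀ ≤ m²`), a renormalized mass
`m² + δm²(e′,λ′,x) ≥ m₀` on `Ω₁` for all `e′ ∈ [e′₀−ρ, e′₀+ρ]` (`ρ > 0`), and data `δm²(·,λ′,x)` (`x ∈ Ω₁`), `E₁(·,λ′)`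
of class `C¹` in `e′`; for the capstone, H7 of `B3Eq14Finite` on the `λ′`-side at `e′ = 0` as well.
HONEST SCOPE: FIRST order in `e′` at fixed `λ′` only — nothing about `∂²_{e′}`, the mixed `∂_{e′}∂_{λ′}` or any term
of (1.5) with `α + β ≥ 2` and `α ≥ 1`, and no joint smoothness in `(e′, λ′)`; `⟨charge vertex⟩` is LEFT as the
normalized product integral — no Wick/cumulant closed form and no identification with the graphs of III §2 (rows of
r15 and the p-seats); the regularity is that of the SUPPLIED data `Data14.dm2`, `Data14.E1` (the printed
counterterms (1.29)/(1.30) are polynomials in `(e′, λ′)`, so `C¹` holds for them, but that instance is not built here).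

presearch (2026-08-22, corpus fts+vec and galaxy panama/pdf): no held or indexed source treats the `e′`-derivative of
Bałaban's `E_k` or its vertex expansion beyond [Balaban1983Higgs3] itself (hits: generic lattice-QFT textbooks
— Montvay–Münster, Greensite, Rebbi ed. — none on (1.4)/(1.5)); the argument above is ours, assembled from (I.1.7),
(I.2.1)–(I.2.6), (III.1.3)–(1.7).

PDF held: `paper:balaban1983-higgs-2-3-quantum-fields-finite-volume` (journal page = PDF page + 410); (1.3)–(1.7)
pp. 412–413 [PDF 2–3] read from the render `run/shared/lean/pub/pub-balaban/b2b-balaban-ref1/pages/` (paper III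
p002–p003) by typer g4/g24; [Balaban1982Higgs1] (1.7) p. 605, (2.1)–(2.6) p. 608 (transports, contours, averages).

CITATION HEADER (lean-in-tree rule).  lit-balaban TYPED SKELETON (HOME `run/shared/lean/pub/lit-balaban/`), rows
**B3.Eq1.4** / **B3.Eq1.5** (owner r15; decls of record `B3Eq14AuxFunction.Data14.auxE`,
`B3Eq15OneSidedInteraction.interaction15R`); unit `lit-balaban-typer` (literature-prover-lit-balaban-typer-g26-0).
Nothing of any other seat is touched; no row changes head (regularity results about the typed instance).
-/

open _root_.MeasureTheory
open scoped InnerProductSpace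

namespace Literature.MathematicalPhysics.QuantumFieldTheory.Balaban1983to89.B3Eq15ChargeDerivative

open Literature.MathematicalPhysics.QuantumFieldTheory.Balaban1983to89.HiggsLattice
open Literature.MathematicalPhysics.QuantumFieldTheory.Balaban1983to89.HiggsAveraging
open Literature.MathematicalPhysics.QuantumFieldTheory.Balaban1983to89.HiggsCovariance
open Literature.MathematicalPhysics.QuantumFieldTheory.Balaban1983to89.HiggsCovariancePos
open Literature.MathematicalPhysics.QuantumFieldTheory.Balaban1983to89.B3MultiscaleFields
open Literature.MathematicalPhysics.QuantumFieldTheory.Balaban1983to89.HiggsFluctMeasure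
open Literature.MathematicalPhysics.QuantumFieldTheory.Balaban1983to89.B1RT
open Literature.MathematicalPhysics.QuantumFieldTheory.Balaban1983to89.B3Eq14AuxFunction
open Literature.MathematicalPhysics.QuantumFieldTheory.Balaban1983to89.B3Eq15OneSidedInteraction
  (sqSum sqSum_nonneg prec_pos sq_le_sqSum)
open Literature.MathematicalPhysics.QuantumFieldTheory.Balaban1983to89.B3Eq14Finite
open Set Filter Topology
open scoped BigOperators

noncomputable section

variable {P : HiggsLattice.Params} {N : ℕ}

/-! ## 1. The charge dependence is affine: contours and bond values of `e′g_kA′ + A^{(k)}` -/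

section Affine

/-- `A ↦ A(segment)` is homogeneous. [cite: Balaban1982Higgs1, (2.3) p.608] -/
theorem segSum_smul (c : ℝ) (A : HiggsLattice.VecField P 0) (u : HiggsLattice.Site P 0) (μ : Fin P.d) (n : ℕ) :
    segSum (c • A) u μ n = c * segSum A u μ n := by
  simp only [segSum, Pi.smul_apply, smul_eq_mul, Finset.mul_sum]

/-- `A ↦ A(Γ_{y,x})` is homogeneous. [cite: Balaban1982Higgs1, (2.1) p.608] -/
theorem contourSum_smul (c : ℝ) (A : HiggsLattice.VecField P 0) (y x : HiggsLattice.Site P 0) :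
    contourSum (c • A) y x = c * contourSum A y x := by
  simp only [contourSum, segSum_smul, Finset.mul_sum]

/-- `A ↦ A(Γ^{(k)}_{y,x})` is homogeneous. [cite: Balaban1982Higgs1, (2.2) p.608] -/
theorem multiContourSum_smul (c : ℝ) (A : HiggsLattice.VecField P 0) (k : ℕ) (x : HiggsLattice.Site P 0) :
    multiContourSum (c • A) k x = c * multiContourSum A k x := by
  simp only [multiContourSum, contourSum_smul, Finset.mul_sum]

/-- `A ↦ ηA(Γ^{(k)})` is homogeneous. [cite: Balaban1983Higgs3, (1.3) p.412] -/
theorem etaSumK_smul (c : ℝ) (A : HiggsLattice.VecField P 0) (k : ℕ) (x : HiggsLattice.Site P 0) :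
    etaSumK (c • A) k x = c * etaSumK A k x := by
  rw [etaSumK_eq, etaSumK_eq, multiContourSum_smul]
  ring

variable {k : ℕ} (D : Data14 P N k)

/-- The CONTOUR FUNCTIONAL OF THE FLUCTUATION FAMILY in (1.3): `a_x(A′) = Σ_{j<k} (g_kA′^{(j),η})(Γ^{(j+1)}_{x_{j+1},x})`,
the coefficient of `e′` in `𝒜(Γ^{(k)}_{y,x})` for the external field `e′g_kA′ + A^{(k)}` (`contour13_extPieces`). (ours)
[cite: Balaban1983Higgs3, (1.3) p.412] -/
noncomputable def fluctContour (A' : (j : Fin k) → HiggsLattice.VecField P j) (x : HiggsLattice.Site P 0) : ℝ :=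
  ∑ j : Fin k, etaSumK (siteMul D.g (fluctPiece D.msq D.a j (A' j))) (j + 1) x

/-- Unfolding of `fluctContour`. [cite: Balaban1983Higgs3, (1.3) p.412] -/
theorem fluctContour_def (A' : (j : Fin k) → HiggsLattice.VecField P j) (x : HiggsLattice.Site P 0) :
    fluctContour D A' x = ∑ j : Fin k, etaSumK (siteMul D.g (fluctPiece D.msq D.a j (A' j))) (j + 1) x := rfl

/-- **(1.3) is AFFINE in the charge**: `𝒜(Γ^{(k)}_{y,x}) = A^{(k)}(Γ^{(k)}_{y,x}) + e′·a_x(A′)` for the external field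
`e′g_kA′ + A^{(k)}` of (1.4). [cite: Balaban1983Higgs3, (1.3)–(1.4) p.412] -/
theorem contour13_extPieces (Ak : HiggsLattice.VecField P 0) (e : ℝ) (A' : (j : Fin k) → HiggsLattice.VecField P j) (x : HiggsLattice.Site P 0) :
    contour13 k (D.extPieces e A') Ak x = etaSumK Ak k x + e * fluctContour D A' x := by
  rw [contour13, fluctContour_def, Finset.mul_sum,
    Finset.sum_range (fun j => etaSumK (D.extPieces e A' j) (j + 1) x), add_comm]
  congr 1
  refine Finset.sum_congr rfl fun j _ => ?_
  rw [D.extPieces_of_lt e A' j.isLt, etaSumK_smul]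

/-- The BOND FUNCTIONAL OF THE FLUCTUATION FAMILY: `G_b(A′) = g_k(b₋)·A′(b)`, `A′ = Σ_{j<k}A′^{(j),η}` (1.1) — the
coefficient of `e′` in the bond value of `e′g_kA′ + A^{(k)}` (`extField_apply`). (ours) [cite: Balaban1983Higgs3, (1.1), (1.4) p.412] -/
noncomputable def fluctBond (A' : (j : Fin k) → HiggsLattice.VecField P j) (b : HiggsLattice.PBond P 0) : ℝ :=
  D.g b.src * D.fluctSum A' b

/-- Unfolding of `fluctBond`. [cite: Balaban1983Higgs3, (1.1), (1.4) p.412] -/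
theorem fluctBond_def (A' : (j : Fin k) → HiggsLattice.VecField P j) (b : HiggsLattice.PBond P 0) :
    fluctBond D A' b = D.g b.src * D.fluctSum A' b := rfl

/-- **The bond values of `e′g_kA′ + A^{(k)}` are affine in the charge**: `(e′g_kA′ + A^{(k)})(b) = A^{(k)}(b) + e′·G_b(A′)`.
[cite: Balaban1983Higgs3, (1.4) p.412] -/
theorem extField_apply (Ak : HiggsLattice.VecField P 0) (e : ℝ) (A' : (j : Fin k) → HiggsLattice.VecField P j) (b : HiggsLattice.PBond P 0) :
    D.extField Ak e A' b = Ak b + e * fluctBond D A' b := by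
  rw [D.extField_eq, fluctBond_def, Pi.add_apply, Pi.smul_apply, siteMul_apply, smul_eq_mul]
  ring

/-! ### Linearity of `a_x(A′)` and `G_b(A′)` in the fluctuation family, and their linear growth -/

/-- `ofSite` is homogeneous. [cite: Balaban1982Higgs1, p.608] -/
theorem ofSite_smul {j : ℕ} (t : ℝ) (f : HiggsLattice.ScalarField P j P.d) : ofSite (t • f) = t • ofSite f := by
  funext b
  simp [ofSite]

/-- `fluctOp` is homogeneous (a composite of linear maps). [cite: Balaban1983Higgs3, (1.2) p.412] -/
theorem fluctOp_smul (msq a : ℝ) (j : ℕ) (t : ℝ) (g : HiggsLattice.ScalarField P j P.d) :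
    fluctOp (P := P) msq a j (t • g) = t • fluctOp msq a j g := by
  rw [fluctOp_eq, fluctOp_eq, map_smul, map_smul, smul_comm]

/-- The pieces (1.2) are additive in the fluctuation field. [cite: Balaban1983Higgs3, (1.2) p.412] -/
theorem fluctPiece_add (msq a : ℝ) : ∀ (j : ℕ) (A B : HiggsLattice.VecField P j),
    fluctPiece msq a j (A + B) = fluctPiece msq a j A + fluctPiece msq a j B
  | 0, A, B => rfl
  | j + 1, A, B => by rw [fluctPiece_succ, fluctPiece_succ, fluctPiece_succ, toSite_add, fluctOp_add, ofSite_add]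

/-- The pieces (1.2) are homogeneous in the fluctuation field. [cite: Balaban1983Higgs3, (1.2) p.412] -/
theorem fluctPiece_smul (msq a : ℝ) : ∀ (j : ℕ) (t : ℝ) (A : HiggsLattice.VecField P j),
    fluctPiece msq a j (t • A) = t • fluctPiece msq a j A
  | 0, t, A => rfl
  | j + 1, t, A => by
      rw [fluctPiece_succ, fluctPiece_succ, HiggsFluctMeasurePos.toSite_smul, fluctOp_smul, ofSite_smul]

/-- `a_x(A′)` is additive. [cite: Balaban1983Higgs3, (1.3) p.412] -/
theorem fluctContour_add (A' B' : (j : Fin k) → HiggsLattice.VecField P j) (x : HiggsLattice.Site P 0) :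
    fluctContour D (A' + B') x = fluctContour D A' x + fluctContour D B' x := by
  simp only [fluctContour_def, Pi.add_apply, fluctPiece_add, siteMul_add, etaSumK_add, Finset.sum_add_distrib]

/-- `a_x(A′)` is homogeneous. [cite: Balaban1983Higgs3, (1.3) p.412] -/
theorem fluctContour_smul (t : ℝ) (A' : (j : Fin k) → HiggsLattice.VecField P j) (x : HiggsLattice.Site P 0) :
    fluctContour D (t • A') x = t * fluctContour D A' x := by
  simp only [fluctContour_def, Pi.smul_apply, fluctPiece_smul, siteMul_smul, etaSumK_smul, Finset.mul_sum]

/-- `G_b(A′)` is additive. [cite: Balaban1983Higgs3, (1.1) p.412] -/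
theorem fluctBond_add (A' B' : (j : Fin k) → HiggsLattice.VecField P j) (b : HiggsLattice.PBond P 0) :
    fluctBond D (A' + B') b = fluctBond D A' b + fluctBond D B' b := by
  simp only [fluctBond_def, Data14.fluctSum, Pi.add_apply, fluctPiece_add, Finset.sum_add_distrib, Finset.sum_apply,
    mul_add]

/-- `G_b(A′)` is homogeneous. [cite: Balaban1983Higgs3, (1.1) p.412] -/
theorem fluctBond_smul (t : ℝ) (A' : (j : Fin k) → HiggsLattice.VecField P j) (b : HiggsLattice.PBond P 0) :
    fluctBond D (t • A') b = t * fluctBond D A' b := by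
  simp only [fluctBond_def, Data14.fluctSum, Pi.smul_apply, fluctPiece_smul, Finset.sum_apply, smul_eq_mul,
    ← Finset.mul_sum]
  ring

/-- A real-valued additive and homogeneous function on a finite-dimensional normed space grows at most linearly.
[folklore] -/
private theorem exists_le_mul_norm_of_linear {E : Type*} [NormedAddCommGroup E] [NormedSpace ℝ E]
    [FiniteDimensional ℝ E] (f : E → ℝ) (hadd : ∀ x y, f (x + y) = f x + f y) (hsmul : ∀ (t : ℝ) x, f (t • x) = t * f x) :
    ∃ C : ℝ, 0 ≤ C ∧ ∀ x, |f x| ≤ C * ‖x‖ := by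
  let L : E →ₗ[ℝ] ℝ := { toFun := f, map_add' := hadd, map_smul' := fun t x => by rw [hsmul]; rfl }
  let Lc : E →L[ℝ] ℝ := LinearMap.toContinuousLinearMap L
  refine ⟨‖Lc‖, norm_nonneg _, fun x => ?_⟩
  have h := Lc.le_opNorm x
  rw [Real.norm_eq_abs] at h
  exact h

/-- **`|a_x(A′)| ≤ C·‖A′‖` uniformly in `x`** (a linear functional of the finite-dimensional family). (ours)
[cite: Balaban1983Higgs3, (1.3) p.412] -/
theorem exists_fluctContour_le : ∃ C : ℝ, 0 ≤ C ∧ ∀ (A' : (j : Fin k) → HiggsLattice.VecField P j) (x : HiggsLattice.Site P 0),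
    |fluctContour D A' x| ≤ C * ‖A'‖ := by
  have h : ∀ x : HiggsLattice.Site P 0, ∃ C : ℝ, 0 ≤ C ∧ ∀ A' : (j : Fin k) → HiggsLattice.VecField P j, |fluctContour D A' x| ≤ C * ‖A'‖ :=
    fun x => exists_le_mul_norm_of_linear (fun A' => fluctContour D A' x) (fun A' B' => fluctContour_add D A' B' x)
      (fun t A' => fluctContour_smul D t A' x)
  choose C hC0 hC using h
  refine ⟨∑ x, C x, Finset.sum_nonneg fun x _ => hC0 x, fun A' x => (hC x A').trans ?_⟩
  exact mul_le_mul_of_nonneg_right (Finset.single_le_sum (fun y _ => hC0 y) (Finset.mem_univ x)) (norm_nonneg _)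

/-- **`|G_b(A′)| ≤ C·‖A′‖` uniformly in `b`.** (ours) [cite: Balaban1983Higgs3, (1.1) p.412] -/
theorem exists_fluctBond_le : ∃ C : ℝ, 0 ≤ C ∧ ∀ (A' : (j : Fin k) → HiggsLattice.VecField P j) (b : HiggsLattice.PBond P 0),
    |fluctBond D A' b| ≤ C * ‖A'‖ := by
  have h : ∀ b : HiggsLattice.PBond P 0, ∃ C : ℝ, 0 ≤ C ∧ ∀ A' : (j : Fin k) → HiggsLattice.VecField P j, |fluctBond D A' b| ≤ C * ‖A'‖ :=
    fun b => exists_le_mul_norm_of_linear (fun A' => fluctBond D A' b) (fun A' B' => fluctBond_add D A' B' b)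
      (fun t A' => fluctBond_smul D t A' b)
  choose C hC0 hC using h
  refine ⟨∑ b, C b, Finset.sum_nonneg fun b _ => hC0 b, fun A' b => (hC b A').trans ?_⟩
  exact mul_le_mul_of_nonneg_right (Finset.single_le_sum (fun y _ => hC0 y) (Finset.mem_univ b)) (norm_nonneg _)

end Affine

/-! ## 2. The `e′`-derivatives of the transports, the averages, the kernel, the covariant derivative, the density -/

section Derivatives

variable {k : ℕ} (D : Data14 P N k)

/-- `d/ds U(a + sg)v = ηeg·qU(a + sg)v` for `U(A) = exp(qηeA)` ((I.1.7)). [cite: Balaban1982Higgs1, (1.7) p.605] -/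
private theorem hasDerivAt_U_aff (C : HiggsLattice.ChargeData N) (η a g : ℝ) (v : EuclideanSpace ℝ (Fin N)) (t : ℝ) :
    HasDerivAt (fun s : ℝ => C.U η (a + s * g) v) ((η * C.e * g) • C.q (C.U η (a + t * g) v)) t := by
  have hθ : HasDerivAt (fun s : ℝ => η * C.e * (a + s * g)) (η * C.e * g) t := by
    refine ((((hasDerivAt_id t).mul_const g).const_add a).const_mul (η * C.e)).congr_deriv ?_
    ring
  have hexp : HasDerivAt (fun u : ℝ => NormedSpace.exp (u • C.q))
      (C.q * NormedSpace.exp ((η * C.e * (a + t * g)) • C.q)) (η * C.e * (a + t * g)) :=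
    hasDerivAt_exp_smul_const' C.q _
  have hcomp := hexp.scomp t hθ
  exact ((ContinuousLinearMap.apply ℝ (EuclideanSpace ℝ (Fin N)) v).hasFDerivAt).comp_hasDerivAt t hcomp

/-- **`∂_{e′}U(𝒜(Γ^{(k)}_{y,x}))v = e·a_x(A′)·q U(𝒜(Γ^{(k)}_{y,x}))v`**: the transport of (1.4) along the contour (1.3)
is differentiable in the charge. [cite: Balaban1983Higgs3, (1.3)–(1.4) p.412] -/
theorem hasDerivAt_holK13_apply (Ak : HiggsLattice.VecField P 0) (A' : (j : Fin k) → HiggsLattice.VecField P j) (x : HiggsLattice.Site P 0)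
    (v : EuclideanSpace ℝ (Fin N)) (e : ℝ) :
    HasDerivAt (fun u => holK13 D.C k (D.extPieces u A') Ak x v)
      ((D.C.e * fluctContour D A' x) • D.C.q (holK13 D.C k (D.extPieces e A') Ak x v)) e := by
  have h := hasDerivAt_U_aff D.C 1 (etaSumK Ak k x) (fluctContour D A' x) v e
  rw [one_mul] at h
  have heq : ∀ u, holK13 D.C k (D.extPieces u A') Ak x = D.C.U 1 (etaSumK Ak k x + u * fluctContour D A' x) :=
    fun u => by rw [holK13, contour13_extPieces]
  simp_rw [heq]
  exact h

/-- The `e′`-DERIVATIVE OF THE AVERAGE `(Q_k(e′g_kA′ + A^{(k)})φ′)(y)`: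
`L^{−kd}Σ_{x∈B^k(y)} e·a_x(A′)·q U(𝒜(Γ^{(k)}_{y,x}))φ′(x)`. (ours) [cite: Balaban1983Higgs3, (1.3)–(1.4) p.412] -/
noncomputable def dAvgQ14 (Ak : HiggsLattice.VecField P 0) (A' : (j : Fin k) → HiggsLattice.VecField P j) (φ' : HiggsLattice.ScalarField P 0 N) (e : ℝ)
    (y : HiggsLattice.Site P k) : EuclideanSpace ℝ (Fin N) :=
  (((P.L : ℝ) ^ (k * P.d))⁻¹) • ∑ x ∈ blockK k y,
    (D.C.e * fluctContour D A' x) • D.C.q (holK13 D.C k (D.extPieces e A') Ak x (φ' x))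

/-- Unfolding of `dAvgQ14`. [cite: Balaban1983Higgs3, (1.3)–(1.4) p.412] -/
theorem dAvgQ14_def (Ak : HiggsLattice.VecField P 0) (A' : (j : Fin k) → HiggsLattice.VecField P j) (φ' : HiggsLattice.ScalarField P 0 N) (e : ℝ)
    (y : HiggsLattice.Site P k) :
    dAvgQ14 D Ak A' φ' e y = (((P.L : ℝ) ^ (k * P.d))⁻¹) • ∑ x ∈ blockK k y,
      (D.C.e * fluctContour D A' x) • D.C.q (holK13 D.C k (D.extPieces e A') Ak x (φ' x)) := rfl

/-- **`e′ ↦ (Q_k(e′g_kA′ + A^{(k)})φ′)(y)` is differentiable**, with derivative `dAvgQ14`.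
[cite: Balaban1983Higgs3, (1.3)–(1.4) p.412] -/
theorem hasDerivAt_avgQ14_apply (Ak : HiggsLattice.VecField P 0) (A' : (j : Fin k) → HiggsLattice.VecField P j) (φ' : HiggsLattice.ScalarField P 0 N)
    (y : HiggsLattice.Site P k) (e : ℝ) :
    HasDerivAt (fun u => D.avgQ14 Ak u A' φ' y) (dAvgQ14 D Ak A' φ' e y) e := by
  simp only [Data14.avgQ14_apply, dAvgQ14_def]
  exact (HasDerivAt.fun_sum fun x _ => hasDerivAt_holK13_apply D Ak A' x (φ' x) e).const_smul
    (((P.L : ℝ) ^ (k * P.d))⁻¹)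

/-- The derivative of a product of single-site kernels along differentiable arguments:
`d/de Π_i t_κ(f_i(e)) = (−κΣ_i⟨f_i, f_i′⟩)·Π_i t_κ(f_i(e))` (`t_κ(v) = (κ/2π)^{N/2}e^{−½κ|v|²}`).
[cite: Balaban1982Higgs1, (2.5)–(2.6) p.608] -/
theorem hasDerivAt_prod_rtKernel {ι : Type*} [Fintype ι] (κ : ℝ) {f : ℝ → ι → EuclideanSpace ℝ (Fin N)}
    {f' : ι → EuclideanSpace ℝ (Fin N)} {e : ℝ} (hf : ∀ i, HasDerivAt (fun u => f u i) (f' i) e) :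
    HasDerivAt (fun u => ∏ i, rtKernel κ (f u i))
      ((-κ * ∑ i, ⟪f e i, f' i⟫_ℝ) * ∏ i, rtKernel κ (f e i)) e := by
  set c : ℝ := (κ / (2 * Real.pi)) ^ ((Module.finrank ℝ (EuclideanSpace ℝ (Fin N)) : ℝ) / 2) with hc
  have hprod : ∀ u, ∏ i, rtKernel κ (f u i) = c ^ Fintype.card ι * Real.exp (∑ i, -(κ / 2) * ‖f u i‖ ^ 2) := by
    intro u
    simp only [rtKernel_eq]
    rw [Finset.prod_mul_distrib, Finset.prod_const, Finset.card_univ, Real.exp_sum]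
  have hsq : ∀ i, HasDerivAt (fun u => ‖f u i‖ ^ 2) (2 * ⟪f e i, f' i⟫_ℝ) e := by
    intro i
    have h := (hf i).inner ℝ (hf i)
    simp_rw [real_inner_self_eq_norm_sq] at h
    refine h.congr_deriv ?_
    rw [real_inner_comm (f' i) (f e i)]
    ring
  have hsum : HasDerivAt (fun u => ∑ i, -(κ / 2) * ‖f u i‖ ^ 2) (∑ i, -(κ / 2) * (2 * ⟪f e i, f' i⟫_ℝ)) e :=
    HasDerivAt.fun_sum fun i _ => (hsq i).const_mul _
  have h := (hsum.exp.const_mul (c ^ Fintype.card ι))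
  have e1 : (fun u => ∏ i, rtKernel κ (f u i)) = fun u => c ^ Fintype.card ι * Real.exp (∑ i, -(κ / 2) * ‖f u i‖ ^ 2) :=
    funext hprod
  rw [e1]
  refine h.congr_deriv ?_
  have e2 : ∑ i, -(κ / 2) * (2 * ⟪f e i, f' i⟫_ℝ) = -κ * ∑ i, ⟪f e i, f' i⟫_ℝ := by
    rw [Finset.mul_sum]
    exact Finset.sum_congr rfl fun i _ => by ring
  rw [hprod e, e2]
  ring

/-- The KERNEL VERTEX: `−κΣ_{y∈Ω^{(k)}}⟨φ(y) − (Q_k(e′g_kA′+A^{(k)})φ′)(y), ∂_{e′}(Q_k(…)φ′)(y)⟩`, `κ = a_k(L^kη)^{d−2}` —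
minus the `e′`-derivative of the exponent `½κΣ_y|φ(y) − (Q_kφ′)(y)|²` of the kernel `t(Ω; φ, φ′)` of (1.4), so that
`∂_{e′}t = −(kernel vertex)·t` (`hasDerivAt_kernel14`). (ours) [cite: Balaban1983Higgs3, (1.4) p.412] -/
noncomputable def kernelVertex (Ak : HiggsLattice.VecField P 0) (A' : (j : Fin k) → HiggsLattice.VecField P j) (φ : HiggsLattice.ScalarField P k N)
    (φΩ : ↥D.Ω → EuclideanSpace ℝ (Fin N)) (e : ℝ) : ℝ :=
  -(prec (B1.aSeq D.a P.L k) (P.mesh k) P.d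
    * ∑ y : ↥D.Ωk, ⟪φ y.1 - D.avgQ14 Ak e A' (extendZero D.Ω φΩ) y.1,
        dAvgQ14 D Ak A' (extendZero D.Ω φΩ) e y.1⟫_ℝ)

/-- Unfolding of `kernelVertex`. [cite: Balaban1983Higgs3, (1.4) p.412] -/
theorem kernelVertex_def (Ak : HiggsLattice.VecField P 0) (A' : (j : Fin k) → HiggsLattice.VecField P j) (φ : HiggsLattice.ScalarField P k N)
    (φΩ : ↥D.Ω → EuclideanSpace ℝ (Fin N)) (e : ℝ) :
    kernelVertex D Ak A' φ φΩ e = -(prec (B1.aSeq D.a P.L k) (P.mesh k) P.d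
      * ∑ y : ↥D.Ωk, ⟪φ y.1 - D.avgQ14 Ak e A' (extendZero D.Ω φΩ) y.1,
          dAvgQ14 D Ak A' (extendZero D.Ω φΩ) e y.1⟫_ℝ) := rfl

/-- **`∂_{e′}t(Ω; φ, φ′) = −(kernel vertex)·t(Ω; φ, φ′)`**: the Gaussian kernel of (1.4) is differentiable in the charge.
[cite: Balaban1983Higgs3, (1.4) p.412] -/
theorem hasDerivAt_kernel14 (Ak : HiggsLattice.VecField P 0) (A' : (j : Fin k) → HiggsLattice.VecField P j) (φ : HiggsLattice.ScalarField P k N)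
    (φΩ : ↥D.Ω → EuclideanSpace ℝ (Fin N)) (e : ℝ) :
    HasDerivAt (fun u => D.kernel14 Ak u A' φ φΩ)
      (-kernelVertex D Ak A' φ φΩ e * D.kernel14 Ak e A' φ φΩ) e := by
  have hf : ∀ y : ↥D.Ωk, HasDerivAt (fun u => φ y.1 - D.avgQ14 Ak u A' (extendZero D.Ω φΩ) y.1)
      (-dAvgQ14 D Ak A' (extendZero D.Ω φΩ) e y.1) e := fun y => by
    have h := (hasDerivAt_avgQ14_apply D Ak A' (extendZero D.Ω φΩ) y.1 e).const_sub (φ y.1)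
    exact h
  have h := hasDerivAt_prod_rtKernel (N := N) (prec (B1.aSeq D.a P.L k) (P.mesh k) P.d) hf
  simp only [Data14.kernel14_eq]
  refine h.congr_deriv ?_
  rw [kernelVertex_def]
  simp only [inner_neg_right, Finset.sum_neg_distrib]
  ring

/-- The `e′`-DERIVATIVE OF THE COVARIANT DERIVATIVE `(D^η_{e′g_kA′+A^{(k)}}φ′)(b)`: `e·G_b(A′)·q U((e′g_kA′+A^{(k)})(b))φ′(b₊)`
(the factor `η⁻¹` of (I.1.7) cancels the `η` of `U(A) = exp(qηeA)`). (ours) [cite: Balaban1982Higgs1, (1.7) p.605] -/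
noncomputable def dCovDeriv (Ak : HiggsLattice.VecField P 0) (A' : (j : Fin k) → HiggsLattice.VecField P j) (φ' : HiggsLattice.ScalarField P 0 N) (e : ℝ)
    (b : HiggsLattice.PBond P 0) : EuclideanSpace ℝ (Fin N) :=
  (D.C.e * fluctBond D A' b) • D.C.q (D.C.U (P.mesh 0) (D.extField Ak e A' b) (φ' b.tgt))

/-- Unfolding of `dCovDeriv`. [cite: Balaban1982Higgs1, (1.7) p.605] -/
theorem dCovDeriv_def (Ak : HiggsLattice.VecField P 0) (A' : (j : Fin k) → HiggsLattice.VecField P j) (φ' : HiggsLattice.ScalarField P 0 N) (e : ℝ)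
    (b : HiggsLattice.PBond P 0) :
    dCovDeriv D Ak A' φ' e b = (D.C.e * fluctBond D A' b) • D.C.q (D.C.U (P.mesh 0) (D.extField Ak e A' b) (φ' b.tgt)) :=
  rfl

/-- **`e′ ↦ (D^η_{e′g_kA′+A^{(k)}}φ′)(b)` is differentiable**, with derivative `dCovDeriv`. [cite: Balaban1982Higgs1, (1.7) p.605] -/
theorem hasDerivAt_covDeriv (Ak : HiggsLattice.VecField P 0) (A' : (j : Fin k) → HiggsLattice.VecField P j) (φ' : HiggsLattice.ScalarField P 0 N)
    (b : HiggsLattice.PBond P 0) (e : ℝ) :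
    HasDerivAt (fun u => covDeriv D.C (D.extField Ak u A') φ' b) (dCovDeriv D Ak A' φ' e b) e := by
  have hη : P.mesh 0 ≠ 0 := (P.mesh_pos 0).ne'
  have hU := hasDerivAt_U_aff D.C (P.mesh 0) (Ak b) (fluctBond D A' b) (φ' b.tgt) e
  have h := (hU.sub_const (φ' b.src)).const_smul ((P.mesh 0)⁻¹)
  have heq : (fun u => covDeriv D.C (D.extField Ak u A') φ' b)
      = fun u => (P.mesh 0)⁻¹ • (D.C.U (P.mesh 0) (Ak b + u * fluctBond D A' b) (φ' b.tgt) - φ' b.src) := by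
    funext u
    rw [covDeriv, extField_apply]
  rw [heq]
  refine h.congr_deriv ?_
  rw [dCovDeriv_def, extField_apply, smul_smul]
  congr 1
  field_simp

/-- HALF the `e′`-derivative of the Neumann form `⟨φ′, (−Δ^η_{e′g_kA′+A^{(k)},Ω})φ′⟩`:
`Σ_{b⊂Ω} η^d⟨(D_{𝒜}φ′)(b), ∂_{e′}(D_{𝒜}φ′)(b)⟩`. (ours) [cite: Balaban1983Higgs3, (1.4) p.412] -/
noncomputable def dirichletVertex (Ak : HiggsLattice.VecField P 0) (A' : (j : Fin k) → HiggsLattice.VecField P j) (φ' : HiggsLattice.ScalarField P 0 N) (e : ℝ) : ℝ :=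
  ∑ b : HiggsLattice.PBond P 0, if Inside D.Ω b then
    P.mesh 0 ^ P.d * ⟪covDeriv D.C (D.extField Ak e A') φ' b, dCovDeriv D Ak A' φ' e b⟫_ℝ else 0

/-- Unfolding of `dirichletVertex`. [cite: Balaban1983Higgs3, (1.4) p.412] -/
theorem dirichletVertex_def (Ak : HiggsLattice.VecField P 0) (A' : (j : Fin k) → HiggsLattice.VecField P j) (φ' : HiggsLattice.ScalarField P 0 N) (e : ℝ) :
    dirichletVertex D Ak A' φ' e = ∑ b : HiggsLattice.PBond P 0, if Inside D.Ω b then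
      P.mesh 0 ^ P.d * ⟪covDeriv D.C (D.extField Ak e A') φ' b, dCovDeriv D Ak A' φ' e b⟫_ℝ else 0 := rfl

/-- **`∂_{e′}½⟨φ′, (−Δ^η_{e′g_kA′+A^{(k)},Ω} + m²(L^kε)²)φ′⟩ = dirichletVertex`** (the Neumann form is the sum over the bonds
inside `Ω` of `η^d|(D_{𝒜}φ′)(b)|²`, `HiggsCovariancePos.siteInner_covLaplacianN`; the mass term carries no charge).
[cite: Balaban1983Higgs3, (1.4) p.412] -/
theorem hasDerivAt_half_siteInner_scalarOp (Ak : HiggsLattice.VecField P 0) (A' : (j : Fin k) → HiggsLattice.VecField P j)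
    (φ' : HiggsLattice.ScalarField P 0 N) (e : ℝ) :
    HasDerivAt (fun u => (1 / 2 : ℝ) * siteInner φ' (D.scalarOp Ak u A' φ'))
      (dirichletVertex D Ak A' φ' e) e := by
  have heq : ∀ u, siteInner φ' (D.scalarOp Ak u A' φ')
      = (∑ b : HiggsLattice.PBond P 0, if Inside D.Ω b then
          P.mesh 0 ^ P.d * ⟪covDeriv D.C (D.extField Ak u A') φ' b, covDeriv D.C (D.extField Ak u A') φ' b⟫_ℝ else 0)
        + D.m2 * D.ell ^ 2 * siteInner φ' φ' := by
    intro u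
    rw [Data14.scalarOp_eq, LinearMap.add_apply, LinearMap.smul_apply, LinearMap.id_apply,
      HiggsFluctMeasurePos.siteInner_add_right, HiggsFluctMeasurePos.siteInner_smul_right, siteInner_covLaplacianN]
  simp_rw [heq]
  have hb : ∀ b : HiggsLattice.PBond P 0, HasDerivAt (fun u => if Inside D.Ω b then
      P.mesh 0 ^ P.d * ⟪covDeriv D.C (D.extField Ak u A') φ' b, covDeriv D.C (D.extField Ak u A') φ' b⟫_ℝ else 0)
      (if Inside D.Ω b then 2 * (P.mesh 0 ^ P.d * ⟪covDeriv D.C (D.extField Ak e A') φ' b, dCovDeriv D Ak A' φ' e b⟫_ℝ)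
        else 0) e := by
    intro b
    by_cases hin : Inside D.Ω b
    · simp only [hin, if_true]
      have h := ((hasDerivAt_covDeriv D Ak A' φ' b e).inner ℝ (hasDerivAt_covDeriv D Ak A' φ' b e)).const_mul
        (P.mesh 0 ^ P.d)
      refine h.congr_deriv ?_
      rw [real_inner_comm (dCovDeriv D Ak A' φ' e b)]
      ring
    · simp only [hin, if_false]
      exact hasDerivAt_const e 0
  have hsum := ((HasDerivAt.fun_sum (u := Finset.univ) fun b _ => hb b).add_const
    (D.m2 * D.ell ^ 2 * siteInner φ' φ')).const_mul (1 / 2 : ℝ)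
  refine hsum.congr_deriv ?_
  rw [dirichletVertex_def, Finset.mul_sum]
  refine Finset.sum_congr rfl fun b _ => ?_
  split_ifs <;> ring

/-- The DENSITY VERTEX in the charge direction: `dirichletVertex + ½Σ_{x∈Ω₁}η^d(∂_{e′}δm²)(e′,λ′,x)(L^kε)²|φ′(x)|² +
(∂_{e′}E₁)(e′,λ′)` — minus the `e′`-derivative of the exponent of the density `exp[…]` of (1.4), so that
`∂_{e′}exp[…] = −(density vertex)·exp[…]` (`hasDerivAt_density14_charge`). (ours) [cite: Balaban1983Higgs3, (1.4)–(1.7) pp.412–413] -/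
noncomputable def densityVertex (Ak : HiggsLattice.VecField P 0) (lam' : ℝ) (A' : (j : Fin k) → HiggsLattice.VecField P j) (φ' : HiggsLattice.ScalarField P 0 N)
    (e : ℝ) : ℝ :=
  dirichletVertex D Ak A' φ' e
    + (1 / 2 : ℝ) * ∑ x ∈ D.Ω₁, P.mesh 0 ^ P.d * deriv (fun u => D.dm2 u lam' x) e * D.ell ^ 2 * ‖φ' x‖ ^ 2
    + deriv (fun u => D.E1 u lam') e

/-- Unfolding of `densityVertex`. [cite: Balaban1983Higgs3, (1.4)–(1.7) pp.412–413] -/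
theorem densityVertex_def (Ak : HiggsLattice.VecField P 0) (lam' : ℝ) (A' : (j : Fin k) → HiggsLattice.VecField P j) (φ' : HiggsLattice.ScalarField P 0 N)
    (e : ℝ) :
    densityVertex D Ak lam' A' φ' e = dirichletVertex D Ak A' φ' e
      + (1 / 2 : ℝ) * ∑ x ∈ D.Ω₁, P.mesh 0 ^ P.d * deriv (fun u => D.dm2 u lam' x) e * D.ell ^ 2 * ‖φ' x‖ ^ 2
      + deriv (fun u => D.E1 u lam') e := rfl

/-- **`∂_{e′}exp[…] = −(density vertex)·exp[…]`**: the density of (1.4) is differentiable in the charge wherever the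
data `δm²(·,λ′,x)` (`x ∈ Ω₁`), `E₁(·,λ′)` are. [cite: Balaban1983Higgs3, (1.4) p.412] -/
theorem hasDerivAt_density14_charge (Ak : HiggsLattice.VecField P 0) (lam' : ℝ) (A' : (j : Fin k) → HiggsLattice.VecField P j)
    (φ' : HiggsLattice.ScalarField P 0 N) {e : ℝ} (hdm2 : ∀ x ∈ D.Ω₁, DifferentiableAt ℝ (fun u => D.dm2 u lam' x) e)
    (hE1 : DifferentiableAt ℝ (fun u => D.E1 u lam') e) :
    HasDerivAt (fun u => D.density14 Ak u lam' A' φ')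
      (-densityVertex D Ak lam' A' φ' e * D.density14 Ak e lam' A' φ') e := by
  have h1 := hasDerivAt_half_siteInner_scalarOp D Ak A' φ' e
  have h3 : HasDerivAt (fun u : ℝ => ∑ x ∈ D.Ω₁, P.mesh 0 ^ P.d * D.dm2 u lam' x * D.ell ^ 2 * ‖φ' x‖ ^ 2)
      (∑ x ∈ D.Ω₁, P.mesh 0 ^ P.d * deriv (fun u => D.dm2 u lam' x) e * D.ell ^ 2 * ‖φ' x‖ ^ 2) e := by
    refine HasDerivAt.fun_sum (u := D.Ω₁)
      (A := fun x u => P.mesh 0 ^ P.d * D.dm2 u lam' x * D.ell ^ 2 * ‖φ' x‖ ^ 2)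
      (A' := fun x => P.mesh 0 ^ P.d * deriv (fun u => D.dm2 u lam' x) e * D.ell ^ 2 * ‖φ' x‖ ^ 2)
      fun x hx => ?_
    exact (((hdm2 x hx).hasDerivAt.const_mul (P.mesh 0 ^ P.d)).mul_const (D.ell ^ 2)).mul_const (‖φ' x‖ ^ 2)
  have h4 : HasDerivAt (fun u : ℝ => D.E1 u lam') (deriv (fun u => D.E1 u lam') e) e := hE1.hasDerivAt
  have hexp : HasDerivAt (fun u : ℝ => -((1 / 2 : ℝ) * siteInner φ' (D.scalarOp Ak u A' φ'))
        - lam' * D.lamRun * ∑ x ∈ D.Ω₁, P.mesh 0 ^ P.d * ‖φ' x‖ ^ 4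
        - (1 / 2 : ℝ) * ∑ x ∈ D.Ω₁, P.mesh 0 ^ P.d * D.dm2 u lam' x * D.ell ^ 2 * ‖φ' x‖ ^ 2
        - D.E1 u lam') (-densityVertex D Ak lam' A' φ' e) e := by
    have h := ((h1.neg.sub_const (lam' * D.lamRun * ∑ x ∈ D.Ω₁, P.mesh 0 ^ P.d * ‖φ' x‖ ^ 4)).sub
      (h3.const_mul (1 / 2 : ℝ))).sub h4
    refine h.congr_deriv ?_
    rw [densityVertex_def]
    ring
  have h := hexp.exp
  have heq : (fun u => D.density14 Ak u lam' A' φ') = fun u => Real.exp (-((1 / 2 : ℝ) * siteInner φ' (D.scalarOp Ak u A' φ'))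
        - lam' * D.lamRun * ∑ x ∈ D.Ω₁, P.mesh 0 ^ P.d * ‖φ' x‖ ^ 4
        - (1 / 2 : ℝ) * ∑ x ∈ D.Ω₁, P.mesh 0 ^ P.d * D.dm2 u lam' x * D.ell ^ 2 * ‖φ' x‖ ^ 2
        - D.E1 u lam') := by
    funext u
    rw [Data14.density14_eq]
    congr 1
    ring
  rw [heq]
  refine h.congr_deriv ?_
  rw [Data14.density14_eq]
  have e2 : -(1 / 2 : ℝ) * siteInner φ' (D.scalarOp Ak e A' φ') = -((1 / 2 : ℝ) * siteInner φ' (D.scalarOp Ak e A' φ')) := by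
    ring
  rw [e2]
  ring

/-- THE CHARGE VERTEX of the integrand `t(Ω;φ,φ′)·exp[…]` of (1.4) on the product of the fluctuation space with the
fibre: `kernelVertex + densityVertex` — minus the `e′`-derivative of the total exponent, so that
`∂_{e′}(t·exp[…]) = −(charge vertex)·t·exp[…]` (`hasDerivAt_fibre14_charge`).  At `e′ = λ′ = 0` its normalized
expectation is the term `α = 1, β = 0` of the repaired (1.5) (`interaction15R_one_eq_expectations`). (ours)
[cite: Balaban1983Higgs3, (1.4)–(1.5) p.412] -/
noncomputable def chargeVertex (lam' : ℝ) (Ak : HiggsLattice.VecField P 0) (φ : HiggsLattice.ScalarField P k N) (e : ℝ)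
    (z : ((i : Fin k) → HiggsLattice.VecField P i) × (↥D.Ω → EuclideanSpace ℝ (Fin N))) : ℝ :=
  kernelVertex D Ak z.1 φ z.2 e + densityVertex D Ak lam' z.1 (extendZero D.Ω z.2) e

/-- Unfolding of `chargeVertex`. [cite: Balaban1983Higgs3, (1.4)–(1.5) p.412] -/
theorem chargeVertex_def (lam' : ℝ) (Ak : HiggsLattice.VecField P 0) (φ : HiggsLattice.ScalarField P k N) (e : ℝ)
    (z : ((i : Fin k) → HiggsLattice.VecField P i) × (↥D.Ω → EuclideanSpace ℝ (Fin N))) :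
    chargeVertex D lam' Ak φ e z = kernelVertex D Ak z.1 φ z.2 e + densityVertex D Ak lam' z.1 (extendZero D.Ω z.2) e :=
  rfl

/-- **`∂_{e′}(t(Ω;φ,φ′)·exp[…]) = −(charge vertex)·t·exp[…]`** at every point of the product space (data
differentiable in `e′` at `(e′, λ′)`). [cite: Balaban1983Higgs3, (1.4)–(1.5) p.412] -/
theorem hasDerivAt_fibre14_charge (lam' : ℝ) (Ak : HiggsLattice.VecField P 0) (φ : HiggsLattice.ScalarField P k N)
    (z : ((i : Fin k) → HiggsLattice.VecField P i) × (↥D.Ω → EuclideanSpace ℝ (Fin N))) {e : ℝ}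
    (hdm2 : ∀ x ∈ D.Ω₁, DifferentiableAt ℝ (fun u => D.dm2 u lam' x) e)
    (hE1 : DifferentiableAt ℝ (fun u => D.E1 u lam') e) :
    HasDerivAt (fun u => D.kernel14 Ak u z.1 φ z.2 * D.density14 Ak u lam' z.1 (extendZero D.Ω z.2))
      (-chargeVertex D lam' Ak φ e z
        * (D.kernel14 Ak e z.1 φ z.2 * D.density14 Ak e lam' z.1 (extendZero D.Ω z.2))) e := by
  have h := (hasDerivAt_kernel14 D Ak z.1 φ z.2 e).mul
    (hasDerivAt_density14_charge D Ak lam' z.1 (extendZero D.Ω z.2) hdm2 hE1)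
  refine h.congr_deriv ?_
  rw [chargeVertex_def]
  ring

end Derivatives

/-! ## 3. Bounds: the charge vertex grows at most like `(K₀ + K₁‖A′‖)(1 + Σ_x|φ′(x)|²)²` -/

section Bounds

variable {k : ℕ} (D : Data14 P N k)

/-- The transports of (1.4) are isometries. [cite: Balaban1982Higgs1, (1.7) p.605] -/
theorem norm_holK13_apply (C : HiggsLattice.ChargeData N) (F : ℕ → HiggsLattice.VecField P 0)
    (Ftop : HiggsLattice.VecField P 0) (x : HiggsLattice.Site P 0) (v : EuclideanSpace ℝ (Fin N)) :
    ‖holK13 C k F Ftop x v‖ = ‖v‖ := by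
  rw [holK13]
  exact B1Ineq233Upper.norm_U_apply C 1 _ v

/-- `‖qw‖ ≤ ‖w‖` (`‖q‖ ≤ 1`, p. 605). [cite: Balaban1982Higgs1, (1.7) p.605] -/
theorem norm_q_apply_le (C : HiggsLattice.ChargeData N) (w : EuclideanSpace ℝ (Fin N)) : ‖C.q w‖ ≤ ‖w‖ :=
  (C.q.le_opNorm w).trans (mul_le_of_le_one_left (norm_nonneg _) C.norm_q_le)

/-- `|v| ≤ 1 + |v|²`. [folklore] -/
private theorem norm_le_one_add_sq (v : EuclideanSpace ℝ (Fin N)) : ‖v‖ ≤ 1 + ‖v‖ ^ 2 := by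
  nlinarith [sq_nonneg (‖v‖ - 1), norm_nonneg v]

/-- `Σ_{x∈B}|φ′(x)| ≤ |T_η| + Σ_x|φ′(x)|²` for any set of sites `B`. [folklore] -/
private theorem sum_norm_le (B : Finset (HiggsLattice.Site P 0)) (φ' : HiggsLattice.ScalarField P 0 N) :
    ∑ x ∈ B, ‖φ' x‖ ≤ (Fintype.card (HiggsLattice.Site P 0) : ℝ) + sqSum φ' := by
  calc ∑ x ∈ B, ‖φ' x‖ ≤ ∑ x, ‖φ' x‖ :=
        Finset.sum_le_sum_of_subset_of_nonneg (Finset.subset_univ B) fun x _ _ => norm_nonneg _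
    _ ≤ ∑ x : HiggsLattice.Site P 0, (1 + ‖φ' x‖ ^ 2) := Finset.sum_le_sum fun x _ => norm_le_one_add_sq (φ' x)
    _ = (Fintype.card (HiggsLattice.Site P 0) : ℝ) + sqSum φ' := by
        rw [Finset.sum_add_distrib, Finset.sum_const, Finset.card_univ, nsmul_eq_mul, mul_one, sqSum]

/-- `|(Q_k(𝒜)φ′)(y)| ≤ L^{−kd}(|T_η| + Σ_x|φ′(x)|²)` (isometric transports). [cite: Balaban1983Higgs3, (1.4) p.412] -/
theorem norm_avgQ14_le (Ak : HiggsLattice.VecField P 0) (e : ℝ) (A' : (j : Fin k) → HiggsLattice.VecField P j)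
    (φ' : HiggsLattice.ScalarField P 0 N) (y : HiggsLattice.Site P k) :
    ‖D.avgQ14 Ak e A' φ' y‖
      ≤ ((P.L : ℝ) ^ (k * P.d))⁻¹ * ((Fintype.card (HiggsLattice.Site P 0) : ℝ) + sqSum φ') := by
  have hL0 : 0 ≤ ((P.L : ℝ) ^ (k * P.d))⁻¹ := by positivity
  rw [Data14.avgQ14_apply, norm_smul, Real.norm_of_nonneg hL0]
  refine mul_le_mul_of_nonneg_left ((norm_sum_le _ _).trans ?_) hL0
  refine le_trans (Finset.sum_le_sum fun x _ => (norm_holK13_apply D.C (D.extPieces e A') Ak x (φ' x)).le) ?_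
  exact sum_norm_le (blockK k y) φ'

/-- `|∂_{e′}(Q_k(𝒜)φ′)(y)| ≤ L^{−kd}|e|C_a‖A′‖(|T_η| + Σ_x|φ′(x)|²)`. [cite: Balaban1983Higgs3, (1.4) p.412] -/
theorem norm_dAvgQ14_le {Ca : ℝ} (hCa0 : 0 ≤ Ca)
    (hCa : ∀ (A' : (j : Fin k) → HiggsLattice.VecField P j) (x : HiggsLattice.Site P 0), |fluctContour D A' x| ≤ Ca * ‖A'‖)
    (Ak : HiggsLattice.VecField P 0) (A' : (j : Fin k) → HiggsLattice.VecField P j) (φ' : HiggsLattice.ScalarField P 0 N)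
    (e : ℝ) (y : HiggsLattice.Site P k) :
    ‖dAvgQ14 D Ak A' φ' e y‖
      ≤ ((P.L : ℝ) ^ (k * P.d))⁻¹ * (|D.C.e| * Ca * ‖A'‖)
          * ((Fintype.card (HiggsLattice.Site P 0) : ℝ) + sqSum φ') := by
  have hL0 : 0 ≤ ((P.L : ℝ) ^ (k * P.d))⁻¹ := by positivity
  rw [dAvgQ14_def, norm_smul, Real.norm_of_nonneg hL0, mul_assoc]
  refine mul_le_mul_of_nonneg_left ((norm_sum_le _ _).trans ?_) hL0
  have hx : ∀ x ∈ blockK k y, ‖(D.C.e * fluctContour D A' x) • D.C.q (holK13 D.C k (D.extPieces e A') Ak x (φ' x))‖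
      ≤ (|D.C.e| * Ca * ‖A'‖) * ‖φ' x‖ := by
    intro x _
    rw [norm_smul, Real.norm_eq_abs, abs_mul]
    refine mul_le_mul ?_ ((norm_q_apply_le D.C _).trans (norm_holK13_apply D.C _ Ak x (φ' x)).le) (norm_nonneg _)
      (by positivity)
    rw [mul_assoc]
    exact mul_le_mul_of_nonneg_left (hCa A' x) (abs_nonneg _)
  refine (Finset.sum_le_sum hx).trans ?_
  rw [← Finset.mul_sum]
  exact mul_le_mul_of_nonneg_left (sum_norm_le (blockK k y) φ') (by positivity)

/-- **The kernel vertex grows at most like `‖A′‖(1 + Σ|φ′|²)²`** (explicit constant). [cite: Balaban1983Higgs3, (1.4) p.412] -/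
theorem abs_kernelVertex_le {Ca : ℝ} (hCa0 : 0 ≤ Ca)
    (hCa : ∀ (A' : (j : Fin k) → HiggsLattice.VecField P j) (x : HiggsLattice.Site P 0), |fluctContour D A' x| ≤ Ca * ‖A'‖)
    (ha : 0 ≤ D.a) (Ak : HiggsLattice.VecField P 0) (A' : (j : Fin k) → HiggsLattice.VecField P j)
    (φ : HiggsLattice.ScalarField P k N) (φΩ : ↥D.Ω → EuclideanSpace ℝ (Fin N)) (e : ℝ) :
    |kernelVertex D Ak A' φ φΩ e|
      ≤ prec (B1.aSeq D.a P.L k) (P.mesh k) P.d * Fintype.card ↥D.Ωk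
          * ((‖φ‖ + ((P.L : ℝ) ^ (k * P.d))⁻¹ * ((Fintype.card (HiggsLattice.Site P 0) : ℝ) + 1))
            * (((P.L : ℝ) ^ (k * P.d))⁻¹ * (|D.C.e| * Ca * ‖A'‖) * ((Fintype.card (HiggsLattice.Site P 0) : ℝ) + 1)))
          * (1 + sqSum (extendZero D.Ω φΩ)) ^ 2 := by
  set φ' := extendZero D.Ω φΩ with hφ'
  set S := sqSum φ' with hS
  set n₀ : ℝ := (Fintype.card (HiggsLattice.Site P 0) : ℝ) with hn₀
  set Lk : ℝ := ((P.L : ℝ) ^ (k * P.d))⁻¹ with hLk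
  set κ := prec (B1.aSeq D.a P.L k) (P.mesh k) P.d with hκ
  have hS0 : 0 ≤ S := sqSum_nonneg _
  have hn0 : 0 ≤ n₀ := by positivity
  have hLk0 : 0 ≤ Lk := by positivity
  have hκ0 : 0 ≤ κ := by
    rw [hκ]; unfold prec; exact mul_nonneg (D.aSeq_nonneg' ha k) (zpow_nonneg (P.mesh_pos k).le _)
  have hy : ∀ y : ↥D.Ωk, |⟪φ y.1 - D.avgQ14 Ak e A' φ' y.1, dAvgQ14 D Ak A' φ' e y.1⟫_ℝ|
      ≤ (‖φ‖ + Lk * (n₀ + S)) * (Lk * (|D.C.e| * Ca * ‖A'‖) * (n₀ + S)) := by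
    intro y
    refine (abs_real_inner_le_norm _ _).trans (mul_le_mul ?_ (norm_dAvgQ14_le D hCa0 hCa Ak A' φ' e y.1)
      (norm_nonneg _) (by positivity))
    exact (norm_sub_le _ _).trans (add_le_add (norm_le_pi_norm φ y.1) (norm_avgQ14_le D Ak e A' φ' y.1))
  rw [kernelVertex_def, abs_neg, abs_mul, abs_of_nonneg hκ0]
  have hsum : |∑ y : ↥D.Ωk, ⟪φ y.1 - D.avgQ14 Ak e A' φ' y.1, dAvgQ14 D Ak A' φ' e y.1⟫_ℝ|
      ≤ Fintype.card ↥D.Ωk * ((‖φ‖ + Lk * (n₀ + S)) * (Lk * (|D.C.e| * Ca * ‖A'‖) * (n₀ + S))) := by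
    refine (Finset.abs_sum_le_sum_abs _ _).trans ?_
    refine (Finset.sum_le_sum fun y _ => hy y).trans ?_
    rw [Finset.sum_const, Finset.card_univ, nsmul_eq_mul]
  refine (mul_le_mul_of_nonneg_left hsum hκ0).trans ?_
  have h1 : n₀ + S ≤ (n₀ + 1) * (1 + S) := by nlinarith
  have h2 : ‖φ‖ + Lk * (n₀ + S) ≤ (‖φ‖ + Lk * (n₀ + 1)) * (1 + S) := by
    have := mul_le_mul_of_nonneg_left h1 hLk0
    nlinarith [norm_nonneg φ, mul_nonneg hLk0 hn0]
  have hE0 : 0 ≤ Lk * (|D.C.e| * Ca * ‖A'‖) := by positivity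
  have h3 : Lk * (|D.C.e| * Ca * ‖A'‖) * (n₀ + S) ≤ Lk * (|D.C.e| * Ca * ‖A'‖) * (n₀ + 1) * (1 + S) := by
    rw [mul_assoc _ (n₀ + 1)]
    exact mul_le_mul_of_nonneg_left h1 hE0
  have h4 : (‖φ‖ + Lk * (n₀ + S)) * (Lk * (|D.C.e| * Ca * ‖A'‖) * (n₀ + S))
      ≤ ((‖φ‖ + Lk * (n₀ + 1)) * (1 + S)) * (Lk * (|D.C.e| * Ca * ‖A'‖) * (n₀ + 1) * (1 + S)) :=
    mul_le_mul h2 h3 (by positivity) (by positivity)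
  have hcard : (0 : ℝ) ≤ Fintype.card ↥D.Ωk := by positivity
  calc κ * (Fintype.card ↥D.Ωk * ((‖φ‖ + Lk * (n₀ + S)) * (Lk * (|D.C.e| * Ca * ‖A'‖) * (n₀ + S))))
      ≤ κ * (Fintype.card ↥D.Ωk * (((‖φ‖ + Lk * (n₀ + 1)) * (1 + S)) * (Lk * (|D.C.e| * Ca * ‖A'‖) * (n₀ + 1) * (1 + S)))) :=
        mul_le_mul_of_nonneg_left (mul_le_mul_of_nonneg_left h4 hcard) hκ0
    _ = κ * Fintype.card ↥D.Ωk * ((‖φ‖ + Lk * (n₀ + 1)) * (Lk * (|D.C.e| * Ca * ‖A'‖) * (n₀ + 1))) * (1 + S) ^ 2 := by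
        ring

/-- `|(D^η_𝒜φ′)(b)| ≤ η⁻¹(|φ′(b₊)| + |φ′(b₋)|)`. [cite: Balaban1982Higgs1, (1.7) p.605] -/
theorem norm_covDeriv_le (C : HiggsLattice.ChargeData N) (A : HiggsLattice.VecField P 0) (φ' : HiggsLattice.ScalarField P 0 N)
    (b : HiggsLattice.PBond P 0) : ‖covDeriv C A φ' b‖ ≤ (P.mesh 0)⁻¹ * (‖φ' b.tgt‖ + ‖φ' b.src‖) := by
  have hη : 0 ≤ (P.mesh 0)⁻¹ := inv_nonneg.2 (P.mesh_pos 0).le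
  rw [covDeriv, norm_smul, Real.norm_of_nonneg hη]
  refine mul_le_mul_of_nonneg_left ((norm_sub_le _ _).trans ?_) hη
  rw [B1Ineq233Upper.norm_U_apply]

/-- `|∂_{e′}(D^η_𝒜φ′)(b)| ≤ |e|C_G‖A′‖|φ′(b₊)|`. [cite: Balaban1982Higgs1, (1.7) p.605] -/
theorem norm_dCovDeriv_le {Cg : ℝ}
    (hCg : ∀ (A' : (j : Fin k) → HiggsLattice.VecField P j) (b : HiggsLattice.PBond P 0), |fluctBond D A' b| ≤ Cg * ‖A'‖)
    (Ak : HiggsLattice.VecField P 0) (A' : (j : Fin k) → HiggsLattice.VecField P j) (φ' : HiggsLattice.ScalarField P 0 N)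
    (e : ℝ) (b : HiggsLattice.PBond P 0) :
    ‖dCovDeriv D Ak A' φ' e b‖ ≤ |D.C.e| * Cg * ‖A'‖ * ‖φ' b.tgt‖ := by
  rw [dCovDeriv_def, norm_smul, Real.norm_eq_abs, abs_mul]
  have h1 : |fluctBond D A' b| ≤ Cg * ‖A'‖ := hCg A' b
  have h2 : ‖D.C.q (D.C.U (P.mesh 0) (D.extField Ak e A' b) (φ' b.tgt))‖ ≤ ‖φ' b.tgt‖ :=
    (norm_q_apply_le D.C _).trans (B1Ineq233Upper.norm_U_apply D.C _ _ _).le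
  have h0 : 0 ≤ Cg * ‖A'‖ := (abs_nonneg _).trans h1
  calc |D.C.e| * |fluctBond D A' b| * ‖D.C.q (D.C.U (P.mesh 0) (D.extField Ak e A' b) (φ' b.tgt))‖
      ≤ |D.C.e| * (Cg * ‖A'‖) * ‖φ' b.tgt‖ :=
        mul_le_mul (mul_le_mul_of_nonneg_left h1 (abs_nonneg _)) h2 (norm_nonneg _) (mul_nonneg (abs_nonneg _) h0)
    _ = |D.C.e| * Cg * ‖A'‖ * ‖φ' b.tgt‖ := by ring

/-- **The Dirichlet vertex grows at most like `‖A′‖Σ|φ′|²`** (explicit constant). [cite: Balaban1983Higgs3, (1.4) p.412] -/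
theorem abs_dirichletVertex_le {Cg : ℝ}
    (hCg : ∀ (A' : (j : Fin k) → HiggsLattice.VecField P j) (b : HiggsLattice.PBond P 0), |fluctBond D A' b| ≤ Cg * ‖A'‖)
    (Ak : HiggsLattice.VecField P 0) (A' : (j : Fin k) → HiggsLattice.VecField P j) (φ' : HiggsLattice.ScalarField P 0 N)
    (e : ℝ) :
    |dirichletVertex D Ak A' φ' e|
      ≤ Fintype.card (HiggsLattice.PBond P 0)
          * (P.mesh 0 ^ P.d * ((P.mesh 0)⁻¹ * (|D.C.e| * Cg * ‖A'‖) * (2 * sqSum φ'))) := by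
  have hη : 0 ≤ (P.mesh 0)⁻¹ := inv_nonneg.2 (P.mesh_pos 0).le
  have hηd : 0 ≤ P.mesh 0 ^ P.d := pow_nonneg (P.mesh_pos 0).le _
  have hCg0 : 0 ≤ Cg * ‖A'‖ := by
    have h := hCg A' ⟨default, ⟨0, P.hd⟩⟩
    exact (abs_nonneg _).trans h
  have hK0 : 0 ≤ |D.C.e| * Cg * ‖A'‖ := by rw [mul_assoc]; exact mul_nonneg (abs_nonneg _) hCg0
  have hb : ∀ b : HiggsLattice.PBond P 0,
      |(if Inside D.Ω b then P.mesh 0 ^ P.d * ⟪covDeriv D.C (D.extField Ak e A') φ' b, dCovDeriv D Ak A' φ' e b⟫_ℝ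
        else 0)| ≤ P.mesh 0 ^ P.d * ((P.mesh 0)⁻¹ * (|D.C.e| * Cg * ‖A'‖) * (2 * sqSum φ')) := by
    intro b
    have hbound : |⟪covDeriv D.C (D.extField Ak e A') φ' b, dCovDeriv D Ak A' φ' e b⟫_ℝ|
        ≤ (P.mesh 0)⁻¹ * (|D.C.e| * Cg * ‖A'‖) * (2 * sqSum φ') := by
      refine (abs_real_inner_le_norm _ _).trans ?_
      refine (mul_le_mul (norm_covDeriv_le D.C _ φ' b) (norm_dCovDeriv_le D hCg Ak A' φ' e b) (norm_nonneg _)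
        (mul_nonneg hη (by positivity))).trans ?_
      have h1 := sq_le_sqSum φ' b.tgt
      have h2 := sq_le_sqSum φ' b.src
      have h3 : (‖φ' b.tgt‖ + ‖φ' b.src‖) * ‖φ' b.tgt‖ ≤ 2 * sqSum φ' := by
        nlinarith [norm_nonneg (φ' b.tgt), norm_nonneg (φ' b.src), sq_nonneg (‖φ' b.tgt‖ - ‖φ' b.src‖)]
      calc (P.mesh 0)⁻¹ * (‖φ' b.tgt‖ + ‖φ' b.src‖) * (|D.C.e| * Cg * ‖A'‖ * ‖φ' b.tgt‖)
          = (P.mesh 0)⁻¹ * (|D.C.e| * Cg * ‖A'‖) * ((‖φ' b.tgt‖ + ‖φ' b.src‖) * ‖φ' b.tgt‖) := by ring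
        _ ≤ (P.mesh 0)⁻¹ * (|D.C.e| * Cg * ‖A'‖) * (2 * sqSum φ') :=
            mul_le_mul_of_nonneg_left h3 (mul_nonneg hη hK0)
    split_ifs
    · rw [abs_mul, abs_of_nonneg hηd]
      exact mul_le_mul_of_nonneg_left hbound hηd
    · rw [abs_zero]
      exact mul_nonneg hηd (mul_nonneg (mul_nonneg hη hK0) (mul_nonneg zero_le_two (sqSum_nonneg _)))
  rw [dirichletVertex_def]
  refine (Finset.abs_sum_le_sum_abs _ _).trans ((Finset.sum_le_sum fun b _ => hb b).trans ?_)
  rw [Finset.sum_const, Finset.card_univ, nsmul_eq_mul]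

/-- **The density vertex grows at most like `K‖A′‖Σ|φ′|² + ½η^dB_δ(L^kε)²Σ|φ′|² + B_E`** given bounds `B_δ`, `B_E` on the
`e′`-derivatives of the data at `(e′, λ′)`. [cite: Balaban1983Higgs3, (1.4)–(1.7) pp.412–413] -/
theorem abs_densityVertex_le {Cg Bd Be : ℝ}
    (hCg : ∀ (A' : (j : Fin k) → HiggsLattice.VecField P j) (b : HiggsLattice.PBond P 0), |fluctBond D A' b| ≤ Cg * ‖A'‖)
    (Ak : HiggsLattice.VecField P 0) (lam' : ℝ) (A' : (j : Fin k) → HiggsLattice.VecField P j)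
    (φ' : HiggsLattice.ScalarField P 0 N) {e : ℝ} (hBd0 : 0 ≤ Bd)
    (hBd : ∀ x ∈ D.Ω₁, |deriv (fun u => D.dm2 u lam' x) e| ≤ Bd) (hBe : |deriv (fun u => D.E1 u lam') e| ≤ Be) :
    |densityVertex D Ak lam' A' φ' e|
      ≤ Fintype.card (HiggsLattice.PBond P 0) * (P.mesh 0 ^ P.d * ((P.mesh 0)⁻¹ * (|D.C.e| * Cg * ‖A'‖) * (2 * sqSum φ')))
        + (1 / 2 : ℝ) * (P.mesh 0 ^ P.d * Bd * D.ell ^ 2 * sqSum φ') + Be := by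
  have hηd : 0 ≤ P.mesh 0 ^ P.d := pow_nonneg (P.mesh_pos 0).le _
  rw [densityVertex_def]
  refine (abs_add_le _ _).trans (add_le_add ((abs_add_le _ _).trans (add_le_add
    (abs_dirichletVertex_le D hCg Ak A' φ' e) ?_)) hBe)
  rw [abs_mul, abs_of_pos (by norm_num : (0 : ℝ) < 1 / 2)]
  refine mul_le_mul_of_nonneg_left ?_ (by norm_num)
  refine (Finset.abs_sum_le_sum_abs _ _).trans ?_
  have hx : ∀ x ∈ D.Ω₁, |P.mesh 0 ^ P.d * deriv (fun u => D.dm2 u lam' x) e * D.ell ^ 2 * ‖φ' x‖ ^ 2|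
      ≤ P.mesh 0 ^ P.d * Bd * D.ell ^ 2 * ‖φ' x‖ ^ 2 := by
    intro x hx
    rw [abs_mul, abs_mul, abs_mul, abs_of_nonneg hηd, abs_of_nonneg (sq_nonneg D.ell), abs_of_nonneg (sq_nonneg ‖φ' x‖)]
    have := hBd x hx
    gcongr
  refine (Finset.sum_le_sum hx).trans ?_
  rw [← Finset.mul_sum]
  refine mul_le_mul_of_nonneg_left ?_ (by positivity)
  unfold sqSum
  exact Finset.sum_le_sum_of_subset_of_nonneg (Finset.subset_univ _) fun x _ _ => sq_nonneg _

end Bounds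

/-! ## 4. One integrable majorant of `∂_{e′}(t·exp[…])`, uniform in `e′` near `e′₀` -/

section Majorant

variable {k : ℕ} (D : Data14 P N k)

/-- `y² ≤ 2t⁻²·e^{ty}` for `y ≥ 0 < t`. [folklore] -/
private theorem sq_le_inv_sq_mul_exp {t y : ℝ} (ht : 0 < t) (hy : 0 ≤ y) : y ^ 2 ≤ 2 * (t⁻¹) ^ 2 * Real.exp (t * y) := by
  have h := Real.pow_div_factorial_le_exp (t * y) (mul_nonneg ht.le hy) 2
  have hf : ((Nat.factorial 2 : ℕ) : ℝ) = 2 := by norm_num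
  rw [hf, div_le_iff₀ (by norm_num : (0 : ℝ) < 2), mul_pow] at h
  have ht2 : 0 < t ^ 2 := pow_pos ht 2
  calc y ^ 2 = (t⁻¹) ^ 2 * (t ^ 2 * y ^ 2) := by field_simp
    _ ≤ (t⁻¹) ^ 2 * (Real.exp (t * y) * 2) := mul_le_mul_of_nonneg_left h (sq_nonneg _)
    _ = 2 * (t⁻¹) ^ 2 * Real.exp (t * y) := by ring

/-- A continuous function is bounded in absolute value on `[a, b]` by a non-negative constant. [folklore] -/
private theorem exists_abs_le_of_continuous {f : ℝ → ℝ} (hf : Continuous f) (a b : ℝ) :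
    ∃ B : ℝ, 0 ≤ B ∧ ∀ s ∈ Set.Icc a b, |f s| ≤ B := by
  obtain ⟨C, hC⟩ := isCompact_Icc.exists_bound_of_continuousOn (hf.continuousOn (s := Set.Icc a b))
  exact ⟨max C 0, le_max_right _ _, fun s hs => ((Real.norm_eq_abs _).symm.le.trans (hC s hs)).trans (le_max_left _ _)⟩

-- v1.1: heartbeat headroom for the one declaration measured at ≥ 90 % of the lake budget (ops-buildfix-2 probe,
-- 2026-08-22T23:2xZ: fails at 180 000, passes at 200 000); proof unchanged.
set_option maxHeartbeats 400000 in
/-- **Pointwise majorant of `∂_{e′}(t(Ω;φ,φ′)·exp[…]) = −(charge vertex)·t·exp[…]`** with every constant explicit: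
`(K₀ + K₁‖A′‖)·M·Π_{x∈Ω}e^{−c|φ′(x)|²}`, `c = m₀(L^kε)²η^d/4`, given the linear bounds of §1 on the contour and
bond functionals, bounds `Bd`, `Be`, `K_E` on `∂_{e′}δm²`, `∂_{e′}E₁`, `|E₁|` at the charge `e′`, and a renormalized
mass `≥ m₀ > 0` on `Ω₁`. [cite: Balaban1983Higgs3, (1.4)–(1.5) p.412] -/
private theorem abs_chargeDeriv_le (ha : 0 ≤ D.a) (hℓ : D.ell ≠ 0) {lam' : ℝ} (hq : 0 ≤ lam' * D.lamRun)
    {e m₀ Ca Cg Bd Be KE : ℝ} (hm₀ : 0 < m₀) (hm₀m : m₀ ≤ D.m2)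
    (hmass : ∀ x ∈ D.Ω₁, m₀ ≤ D.m2 + D.dm2 e lam' x) (hCa0 : 0 ≤ Ca)
    (hCa : ∀ (A' : (j : Fin k) → HiggsLattice.VecField P j) (x : HiggsLattice.Site P 0),
      |fluctContour D A' x| ≤ Ca * ‖A'‖)
    (hCg0 : 0 ≤ Cg)
    (hCg : ∀ (A' : (j : Fin k) → HiggsLattice.VecField P j) (b : HiggsLattice.PBond P 0),
      |fluctBond D A' b| ≤ Cg * ‖A'‖)
    (hBd0 : 0 ≤ Bd) (hBd : ∀ x ∈ D.Ω₁, |deriv (fun u => D.dm2 u lam' x) e| ≤ Bd) (hBe0 : 0 ≤ Be)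
    (hBe : |deriv (fun u => D.E1 u lam') e| ≤ Be) (hKE : |D.E1 e lam'| ≤ KE)
    (Ak : HiggsLattice.VecField P 0) (φ : HiggsLattice.ScalarField P k N)
    (z : ((i : Fin k) → HiggsLattice.VecField P i) × (↥D.Ω → EuclideanSpace ℝ (Fin N))) :
    |chargeVertex D lam' Ak φ e z * (D.kernel14 Ak e z.1 φ z.2 * D.density14 Ak e lam' z.1 (extendZero D.Ω z.2))|
      ≤ (((1 / 2 : ℝ) * (P.mesh 0 ^ P.d * Bd * D.ell ^ 2) + Be)
          + (prec (B1.aSeq D.a P.L k) (P.mesh k) P.d * Fintype.card ↥D.Ωk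
                * ((‖φ‖ + ((P.L : ℝ) ^ (k * P.d))⁻¹ * ((Fintype.card (HiggsLattice.Site P 0) : ℝ) + 1))
                  * (((P.L : ℝ) ^ (k * P.d))⁻¹ * (|D.C.e| * Ca)
                    * ((Fintype.card (HiggsLattice.Site P 0) : ℝ) + 1)))
              + Fintype.card (HiggsLattice.PBond P 0) * (P.mesh 0 ^ P.d * ((P.mesh 0)⁻¹ * (|D.C.e| * Cg))))
            * ‖z.1‖)
        * (((prec (B1.aSeq D.a P.L k) (P.mesh k) P.d / (2 * Real.pi))
              ^ ((Module.finrank ℝ (EuclideanSpace ℝ (Fin N)) : ℝ) / 2)) ^ Fintype.card ↥D.Ωk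
            * Real.exp KE
            * (2 * ((m₀ * D.ell ^ 2 * P.mesh 0 ^ P.d / 4)⁻¹) ^ 2 * Real.exp (m₀ * D.ell ^ 2 * P.mesh 0 ^ P.d / 4)))
        * ∏ x, Real.exp (-(m₀ * D.ell ^ 2 * P.mesh 0 ^ P.d / 4) * ‖z.2 x‖ ^ 2) := by
  have hη1 : 0 < P.mesh 0 := P.mesh_pos 0
  have hη : 0 < P.mesh 0 ^ P.d := pow_pos hη1 _
  set κ : ℝ := prec (B1.aSeq D.a P.L k) (P.mesh k) P.d with hκdef
  have hκ0 : 0 ≤ κ := by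
    rw [hκdef]; unfold prec; exact mul_nonneg (D.aSeq_nonneg' ha k) (zpow_nonneg (P.mesh_pos k).le _)
  set Cκ : ℝ := ((κ / (2 * Real.pi)) ^ ((Module.finrank ℝ (EuclideanSpace ℝ (Fin N)) : ℝ) / 2))
      ^ Fintype.card ↥D.Ωk with hCκ
  have hCκ0 : 0 ≤ Cκ := pow_nonneg (Real.rpow_nonneg (by positivity) _) _
  set c : ℝ := m₀ * D.ell ^ 2 * P.mesh 0 ^ P.d / 4 with hcdef
  have hℓ2 : 0 < D.ell ^ 2 := by positivity
  have hc : 0 < c := by positivity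
  set Lk : ℝ := ((P.L : ℝ) ^ (k * P.d))⁻¹ with hLk
  have hLk0 : 0 ≤ Lk := by positivity
  set n₀ : ℝ := (Fintype.card (HiggsLattice.Site P 0) : ℝ) with hn₀
  have hn₀0 : 0 ≤ n₀ := Nat.cast_nonneg _
  set A₁ : ℝ := κ * Fintype.card ↥D.Ωk * ((‖φ‖ + Lk * (n₀ + 1)) * (Lk * (|D.C.e| * Ca) * (n₀ + 1))) with hA₁
  set A₂ : ℝ := Fintype.card (HiggsLattice.PBond P 0) * (P.mesh 0 ^ P.d * ((P.mesh 0)⁻¹ * (|D.C.e| * Cg)))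
    with hA₂
  have hA₁0 : 0 ≤ A₁ := by positivity
  have hA₂0 : 0 ≤ A₂ := by positivity
  have hW : 0 ≤ P.mesh 0 ^ P.d * Bd * D.ell ^ 2 := by positivity
  set K₀ : ℝ := (1 / 2 : ℝ) * (P.mesh 0 ^ P.d * Bd * D.ell ^ 2) + Be with hK₀
  have hK₀0 : 0 ≤ K₀ := by positivity
  set M : ℝ := Cκ * Real.exp KE * (2 * (c⁻¹) ^ 2 * Real.exp c) with hM
  -- the factors of `t·exp[…]` and the two vertices
  have hkern : D.kernel14 Ak e z.1 φ z.2 ≤ Cκ := kernel14_le D ha Ak e z.1 φ z.2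
  have hkern0 : 0 ≤ D.kernel14 Ak e z.1 φ z.2 := D.kernel14_nonneg ha Ak e z.1 φ z.2
  have hdens := density14_le_explicit D hℓ hm₀ hm₀m hmass hq Ak z.1 (extendZero D.Ω z.2)
  have hdens0 : 0 ≤ D.density14 Ak e lam' z.1 (extendZero D.Ω z.2) :=
    (D.density14_pos Ak e lam' z.1 (extendZero D.Ω z.2)).le
  have hkv : |kernelVertex D Ak z.1 φ z.2 e|
      ≤ κ * Fintype.card ↥D.Ωk * ((‖φ‖ + Lk * (n₀ + 1)) * (Lk * (|D.C.e| * Ca * ‖z.1‖) * (n₀ + 1)))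
        * (1 + sqSum (extendZero D.Ω z.2)) ^ 2 :=
    abs_kernelVertex_le D hCa0 hCa ha Ak z.1 φ z.2 e
  have hdv : |densityVertex D Ak lam' z.1 (extendZero D.Ω z.2) e|
      ≤ Fintype.card (HiggsLattice.PBond P 0)
          * (P.mesh 0 ^ P.d * ((P.mesh 0)⁻¹ * (|D.C.e| * Cg * ‖z.1‖) * (2 * sqSum (extendZero D.Ω z.2))))
        + (1 / 2 : ℝ) * (P.mesh 0 ^ P.d * Bd * D.ell ^ 2 * sqSum (extendZero D.Ω z.2)) + Be :=
    abs_densityVertex_le D hCg Ak lam' z.1 (extendZero D.Ω z.2) hBd0 hBd hBe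
  have hS : sqSum (extendZero D.Ω z.2) = ∑ x, ‖z.2 x‖ ^ 2 := sqSum_extendZero D.Ω z.2
  set S : ℝ := sqSum (extendZero D.Ω z.2) with hSdef
  have hS0 : 0 ≤ S := sqSum_nonneg _
  have e3 : m₀ * D.ell ^ 2 * P.mesh 0 ^ P.d / 2 = 2 * c := by rw [hcdef]; ring
  rw [e3] at hdens
  -- the vertex bound `(K₀ + (A₁ + A₂)‖A′‖)(1+S)²`
  have h1S' : 1 ≤ 1 + S := le_add_of_nonneg_right hS0
  have h1S : 1 ≤ (1 + S) ^ 2 := one_le_pow₀ h1S'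
  have hSS : S ≤ (1 + S) ^ 2 :=
    (le_add_of_nonneg_left zero_le_one : S ≤ 1 + S).trans (le_self_pow₀ h1S' two_ne_zero)
  have h2S : 2 * S ≤ (1 + S) ^ 2 := by
    have e2 : (1 + S) ^ 2 = 2 * S + (1 + S ^ 2) := by ring
    rw [e2]
    exact le_add_of_nonneg_right (by positivity)
  have hA0 := norm_nonneg z.1
  have hvert : |chargeVertex D lam' Ak φ e z| ≤ (K₀ + (A₁ + A₂) * ‖z.1‖) * (1 + S) ^ 2 := by
    rw [chargeVertex_def]
    refine (abs_add_le _ _).trans ?_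
    have t0 := mul_le_mul_of_nonneg_left h2S (mul_nonneg hA₂0 hA0)
    have t1 := mul_le_mul_of_nonneg_left hSS hW
    have t2 := mul_le_mul_of_nonneg_left h1S hBe0
    have ekv : κ * Fintype.card ↥D.Ωk * ((‖φ‖ + Lk * (n₀ + 1)) * (Lk * (|D.C.e| * Ca * ‖z.1‖) * (n₀ + 1)))
        * (1 + S) ^ 2 = A₁ * ‖z.1‖ * (1 + S) ^ 2 := by
      rw [hA₁]; ring
    have edv : Fintype.card (HiggsLattice.PBond P 0)
          * (P.mesh 0 ^ P.d * ((P.mesh 0)⁻¹ * (|D.C.e| * Cg * ‖z.1‖) * (2 * S))) = A₂ * ‖z.1‖ * (2 * S) := by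
      rw [hA₂]; ring
    rw [ekv] at hkv
    rw [edv] at hdv
    rw [hK₀]
    linarith [hkv, hdv, t0, t1, t2]
  -- the integrand bound `t·exp[…] ≤ Cκ e^{K_E} e^{−2cS}`
  have hprod : D.kernel14 Ak e z.1 φ z.2 * D.density14 Ak e lam' z.1 (extendZero D.Ω z.2)
      ≤ Cκ * (Real.exp KE * Real.exp (-(2 * c * S))) := by
    have h1 : D.kernel14 Ak e z.1 φ z.2 * D.density14 Ak e lam' z.1 (extendZero D.Ω z.2)
        ≤ Cκ * Real.exp (-D.E1 e lam' - 2 * c * S) := mul_le_mul hkern hdens hdens0 hCκ0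
    have h2 : Real.exp (-D.E1 e lam' - 2 * c * S) ≤ Real.exp KE * Real.exp (-(2 * c * S)) := by
      rw [← Real.exp_add, Real.exp_le_exp]
      have := (neg_le_abs (D.E1 e lam')).trans hKE
      linarith
    exact h1.trans (mul_le_mul_of_nonneg_left h2 hCκ0)
  -- `(1+S)² e^{−2cS} ≤ 2c⁻² e^{c} e^{−cS}`
  have hsq : (1 + S) ^ 2 * Real.exp (-(2 * c * S)) ≤ (2 * (c⁻¹) ^ 2 * Real.exp c) * Real.exp (-c * S) := by
    have h := sq_le_inv_sq_mul_exp hc (by positivity : (0 : ℝ) ≤ 1 + S)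
    have e4 : Real.exp (c * (1 + S)) * Real.exp (-(2 * c * S)) = Real.exp c * Real.exp (-c * S) := by
      rw [← Real.exp_add, ← Real.exp_add]
      congr 1
      ring
    calc (1 + S) ^ 2 * Real.exp (-(2 * c * S))
        ≤ (2 * (c⁻¹) ^ 2 * Real.exp (c * (1 + S))) * Real.exp (-(2 * c * S)) :=
          mul_le_mul_of_nonneg_right h (Real.exp_pos _).le
      _ = 2 * (c⁻¹) ^ 2 * (Real.exp (c * (1 + S)) * Real.exp (-(2 * c * S))) := by ring
      _ = (2 * (c⁻¹) ^ 2 * Real.exp c) * Real.exp (-c * S) := by rw [e4]; ring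
  have egauss : Real.exp (-c * S) = ∏ x, Real.exp (-c * ‖z.2 x‖ ^ 2) := by
    rw [← Real.exp_sum, hS, Finset.mul_sum]
  rw [abs_mul, abs_of_nonneg (mul_nonneg hkern0 hdens0)]
  calc |chargeVertex D lam' Ak φ e z| * (D.kernel14 Ak e z.1 φ z.2 * D.density14 Ak e lam' z.1 (extendZero D.Ω z.2))
      ≤ ((K₀ + (A₁ + A₂) * ‖z.1‖) * (1 + S) ^ 2) * (Cκ * (Real.exp KE * Real.exp (-(2 * c * S)))) :=
        mul_le_mul hvert hprod (mul_nonneg hkern0 hdens0) (by positivity)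
    _ = (K₀ + (A₁ + A₂) * ‖z.1‖) * (Cκ * Real.exp KE) * ((1 + S) ^ 2 * Real.exp (-(2 * c * S))) := by ring
    _ ≤ (K₀ + (A₁ + A₂) * ‖z.1‖) * (Cκ * Real.exp KE) * ((2 * (c⁻¹) ^ 2 * Real.exp c) * Real.exp (-c * S)) :=
        mul_le_mul_of_nonneg_left hsq (by positivity)
    _ = (K₀ + (A₁ + A₂) * ‖z.1‖) * M * ∏ x, Real.exp (-c * ‖z.2 x‖ ^ 2) := by rw [← egauss, hM]; ring

/-- **ONE INTEGRABLE MAJORANT of `∂_{e′}(t(Ω;φ,φ′)·exp[…]) = −(charge vertex)·t·exp[…]`, uniform in `e′ ∈ [e′₀−ρ, e′₀+ρ]`**: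
`(K₀ + K₁‖A′‖)·M·Π_{x∈Ω}e^{−c|φ′(x)|²}` — integrable against `Π_j dμ_{C^{(j)}} ⊗ dφ′↾_Ω` by the first moment of the
fluctuation family (`HiggsFluctMeasureExpMoments`) and the Gaussian fibre.  Hypotheses: the well-definedness hypotheses
of `B3Eq14Finite` §4 at the fixed `λ′` (`λ′λ(L^kε) ≥ 0`), a renormalized mass uniformly positive for `e′` in the
interval, and data `δm²(·,λ′,x)`, `E₁(·,λ′)` of class `C¹` in `e′`. [cite: Balaban1983Higgs3, (1.4)–(1.5) p.412] -/
theorem exists_chargeDeriv_majorant (hmsq : 0 < D.msq) (ha : 0 < D.a) (hL : 1 < (P.L : ℝ)) (hk : k ≤ P.K)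
    (hℓ : D.ell ≠ 0) {lam' : ℝ} (hq : 0 ≤ lam' * D.lamRun) {e₀ ρ m₀ : ℝ} (hm₀ : 0 < m₀) (hm₀m : m₀ ≤ D.m2)
    (hmass : ∀ e ∈ Set.Icc (e₀ - ρ) (e₀ + ρ), ∀ x ∈ D.Ω₁, m₀ ≤ D.m2 + D.dm2 e lam' x)
    (hdm2 : ∀ x ∈ D.Ω₁, ContDiff ℝ 1 (fun e => D.dm2 e lam' x)) (hE1 : ContDiff ℝ 1 (fun e => D.E1 e lam'))
    (Ak : HiggsLattice.VecField P 0) (φ : HiggsLattice.ScalarField P k N) :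
    ∃ bound : ((i : Fin k) → HiggsLattice.VecField P i) × (↥D.Ω → EuclideanSpace ℝ (Fin N)) → ℝ,
      Integrable bound ((fluctFamily P D.msq D.a k).prod volume) ∧
      ∀ e ∈ Set.Icc (e₀ - ρ) (e₀ + ρ),
        ∀ z : ((i : Fin k) → HiggsLattice.VecField P i) × (↥D.Ω → EuclideanSpace ℝ (Fin N)),
          |chargeVertex D lam' Ak φ e z
            * (D.kernel14 Ak e z.1 φ z.2 * D.density14 Ak e lam' z.1 (extendZero D.Ω z.2))| ≤ bound z := by
  haveI := HiggsFluctMeasurePos.fluctFamily_isProbability (P := P) hmsq ha hL hk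
  have hη1 : 0 < P.mesh 0 := P.mesh_pos 0
  -- uniform constants on the interval
  obtain ⟨Ca, hCa0, hCa⟩ := exists_fluctContour_le D
  obtain ⟨Cg, hCg0, hCg⟩ := exists_fluctBond_le D
  have hBdx : ∀ x : HiggsLattice.Site P 0, ∃ B : ℝ, 0 ≤ B ∧ (x ∈ D.Ω₁ → ∀ e ∈ Set.Icc (e₀ - ρ) (e₀ + ρ),
      |deriv (fun u => D.dm2 u lam' x) e| ≤ B) := by
    intro x
    by_cases hx : x ∈ D.Ω₁
    · obtain ⟨B, hB0, hB⟩ := exists_abs_le_of_continuous ((hdm2 x hx).continuous_deriv le_rfl) (e₀ - ρ) (e₀ + ρ)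
      exact ⟨B, hB0, fun _ => hB⟩
    · exact ⟨0, le_rfl, fun h => absurd h hx⟩
  choose B hB0 hB using hBdx
  have hBd0 : 0 ≤ ∑ x, B x := Finset.sum_nonneg fun x _ => hB0 x
  have hBd' : ∀ e ∈ Set.Icc (e₀ - ρ) (e₀ + ρ), ∀ x ∈ D.Ω₁, |deriv (fun u => D.dm2 u lam' x) e| ≤ ∑ x, B x :=
    fun e he x hx => (hB x hx e he).trans (Finset.single_le_sum (fun y _ => hB0 y) (Finset.mem_univ x))
  obtain ⟨Be, hBe0, hBe⟩ := exists_abs_le_of_continuous (hE1.continuous_deriv le_rfl) (e₀ - ρ) (e₀ + ρ)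
  obtain ⟨KE, -, hKE⟩ := exists_abs_le_of_continuous hE1.continuous (e₀ - ρ) (e₀ + ρ)
  have hκ0 : 0 ≤ prec (B1.aSeq D.a P.L k) (P.mesh k) P.d := by
    unfold prec; exact mul_nonneg (D.aSeq_nonneg' ha.le k) (zpow_nonneg (P.mesh_pos k).le _)
  have hℓ2 : 0 < D.ell ^ 2 := by positivity
  set K₀ : ℝ := (1 / 2 : ℝ) * (P.mesh 0 ^ P.d * (∑ x, B x) * D.ell ^ 2) + Be with hK₀
  set K₁ : ℝ := prec (B1.aSeq D.a P.L k) (P.mesh k) P.d * Fintype.card ↥D.Ωk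
        * ((‖φ‖ + ((P.L : ℝ) ^ (k * P.d))⁻¹ * ((Fintype.card (HiggsLattice.Site P 0) : ℝ) + 1))
          * (((P.L : ℝ) ^ (k * P.d))⁻¹ * (|D.C.e| * Ca) * ((Fintype.card (HiggsLattice.Site P 0) : ℝ) + 1)))
      + Fintype.card (HiggsLattice.PBond P 0) * (P.mesh 0 ^ P.d * ((P.mesh 0)⁻¹ * (|D.C.e| * Cg))) with hK₁
  set c : ℝ := m₀ * D.ell ^ 2 * P.mesh 0 ^ P.d / 4 with hcdef
  have hc : 0 < c := by positivity
  set M : ℝ := ((prec (B1.aSeq D.a P.L k) (P.mesh k) P.d / (2 * Real.pi))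
        ^ ((Module.finrank ℝ (EuclideanSpace ℝ (Fin N)) : ℝ) / 2)) ^ Fintype.card ↥D.Ωk
      * Real.exp KE * (2 * (c⁻¹) ^ 2 * Real.exp c) with hM
  have hK₀0 : 0 ≤ K₀ := by positivity
  have hK₁0 : 0 ≤ K₁ := by positivity
  have hM0 : 0 ≤ M := by positivity
  refine ⟨fun z => (K₀ + K₁ * ‖z.1‖) * M * ∏ x, Real.exp (-c * ‖z.2 x‖ ^ 2), ?_, fun e he z => ?_⟩
  · -- integrability: first moment of the family times the Gaussian fibre
    have h1 : Integrable (fun A' : (i : Fin k) → HiggsLattice.VecField P i => (K₀ + K₁ * ‖A'‖) * M)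
        (fluctFamily P D.msq D.a k) := by
      refine HiggsFluctMeasureExpMoments.integrable_of_polyGrowth_fluctFamily hmsq ha hL hk
        (((continuous_const.add (continuous_const.mul continuous_norm)).mul continuous_const).aestronglyMeasurable)
        (C := (K₀ + K₁) * M) (p := 1) fun A' => ?_
      rw [abs_of_nonneg (by positivity), pow_one]
      nlinarith [mul_nonneg (mul_nonneg hK₀0 hM0) (norm_nonneg A'), mul_nonneg hK₁0 hM0, norm_nonneg A']
    exact h1.mul_prod (integrable_gauss_fibre D hc)
  · exact abs_chargeDeriv_le D ha.le hℓ hq hm₀ hm₀m (hmass e he) hCa0 hCa hCg0 hCg hBd0 (hBd' e he) hBe0 (hBe e he)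
      (hKE e he) Ak φ z

/-- Measurability of an `e′`-derivative from that of the difference quotients (`F(e′, ·)` measurable for every `e′`).
[folklore] -/
private theorem aestronglyMeasurable_of_hasDerivAt_param {Z : Type*} [MeasurableSpace Z] {ν : Measure Z}
    {F : ℝ → Z → ℝ} {G : Z → ℝ} {e₀ : ℝ} (hF : ∀ e, AEStronglyMeasurable (F e) ν)
    (hderiv : ∀ z, HasDerivAt (fun e => F e z) (G z) e₀) : AEStronglyMeasurable G ν := by
  set u : ℕ → ℝ := fun m => e₀ + 1 / ((m : ℝ) + 1) with hu
  have hu_tend : Tendsto u atTop (𝓝[≠] e₀) := by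
    refine tendsto_nhdsWithin_of_tendsto_nhds_of_eventually_within _ ?_ (Eventually.of_forall fun m => ?_)
    · have h : Tendsto (fun m : ℕ => e₀ + 1 / ((m : ℝ) + 1)) atTop (𝓝 (e₀ + 0)) :=
        tendsto_const_nhds.add tendsto_one_div_add_atTop_nhds_zero_nat
      rw [add_zero] at h
      exact h
    · simp only [hu, Set.mem_compl_iff, Set.mem_singleton_iff, add_eq_left, one_div, inv_eq_zero]
      exact Nat.cast_add_one_ne_zero m
  have hlim : ∀ z, Tendsto (fun m => slope (fun e => F e z) e₀ (u m)) atTop (𝓝 (G z)) :=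
    fun z => (hderiv z).tendsto_slope.comp hu_tend
  refine aestronglyMeasurable_of_tendsto_ae atTop (fun m => ?_) (Eventually.of_forall hlim)
  have e : (fun z => slope (fun e => F e z) e₀ (u m)) = fun z => (u m - e₀)⁻¹ * (F (u m) z - F e₀ z) := by
    funext z; rw [slope_def_field, div_eq_inv_mul]
  rw [e]
  exact ((hF (u m)).sub (hF e₀)).const_mul _

end Majorant

/-! ## 5. Differentiation under the integral sign in `e′`: `∂_{e′}exp(−E_k)` and `∂_{e′}E_k` -/

section ChargeDerivative

variable {k : ℕ} (D : Data14 P N k)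

/-- **THE `e′`-DERIVATIVE OF THE NESTED INTEGRAL OF (1.4) EXISTS** (two-sided, at every `e′₀`) for fixed `λ′` with
`λ′λ(L^kε) ≥ 0`, and equals `−∫∫ (charge vertex)·t·exp[…] d(Π_jdμ ⊗ dφ′↾_Ω)`: dominated differentiation in the charge
(Mathlib's `hasDerivAt_integral_of_dominated_loc_of_deriv_le` on the product of the fluctuation measure with the
fibre Lebesgue measure, majorant `exists_chargeDeriv_majorant`).  Hypotheses: those of `B3Eq14Finite` §4, a
renormalized mass uniformly positive for `e′ ∈ [e′₀−ρ, e′₀+ρ]`, data `δm²(·,λ′,x)`, `E₁(·,λ′)` of class `C¹` in `e′`.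
[cite: Balaban1983Higgs3, (1.4)–(1.5) p.412] -/
theorem hasDerivAt_integral_integrand14_charge (hmsq : 0 < D.msq) (ha : 0 < D.a) (hL : 1 < (P.L : ℝ))
    (hk : k ≤ P.K) (hℓ : D.ell ≠ 0) {lam' : ℝ} (hq : 0 ≤ lam' * D.lamRun) {e₀ ρ m₀ : ℝ} (hρ : 0 < ρ) (hm₀ : 0 < m₀)
    (hm₀m : m₀ ≤ D.m2) (hmass : ∀ e ∈ Set.Icc (e₀ - ρ) (e₀ + ρ), ∀ x ∈ D.Ω₁, m₀ ≤ D.m2 + D.dm2 e lam' x)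
    (hdm2 : ∀ x ∈ D.Ω₁, ContDiff ℝ 1 (fun e => D.dm2 e lam' x)) (hE1 : ContDiff ℝ 1 (fun e => D.E1 e lam'))
    (Ak : HiggsLattice.VecField P 0) (φ : HiggsLattice.ScalarField P k N) :
    HasDerivAt (fun e => ∫ A', D.integrand14 e lam' Ak φ A' ∂(fluctFamily P D.msq D.a k))
      (-(∫ z, chargeVertex D lam' Ak φ e₀ z
          * (D.kernel14 Ak e₀ z.1 φ z.2 * D.density14 Ak e₀ lam' z.1 (extendZero D.Ω z.2))
          ∂((fluctFamily P D.msq D.a k).prod volume))) e₀ := by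
  haveI := HiggsFluctMeasurePos.fluctFamily_isProbability (P := P) hmsq ha hL hk
  set μ := fluctFamily P D.msq D.a k with hμ
  have hm2 : 0 < D.m2 := lt_of_lt_of_le hm₀ hm₀m
  set I : Set ℝ := Set.Icc (e₀ - ρ) (e₀ + ρ) with hI
  have hI_nhds : I ∈ 𝓝 e₀ := Icc_mem_nhds (by linarith) (by linarith)
  have he₀ : e₀ ∈ I := ⟨by linarith, by linarith⟩
  have hdm2d : ∀ x ∈ D.Ω₁, ∀ e, DifferentiableAt ℝ (fun u => D.dm2 u lam' x) e :=
    fun x hx e => ((hdm2 x hx).differentiable one_ne_zero).differentiableAt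
  have hE1d : ∀ e, DifferentiableAt ℝ (fun u => D.E1 u lam') e := fun e => (hE1.differentiable one_ne_zero).differentiableAt
  set F : ℝ → ((i : Fin k) → HiggsLattice.VecField P i) × (↥D.Ω → EuclideanSpace ℝ (Fin N)) → ℝ :=
    fun e z => D.kernel14 Ak e z.1 φ z.2 * D.density14 Ak e lam' z.1 (extendZero D.Ω z.2) with hF
  set F' : ℝ → ((i : Fin k) → HiggsLattice.VecField P i) × (↥D.Ω → EuclideanSpace ℝ (Fin N)) → ℝ :=
    fun e z => -chargeVertex D lam' Ak φ e z * F e z with hF'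
  have hderiv : ∀ z e, HasDerivAt (fun u => F u z) (F' e z) e := fun z e =>
    hasDerivAt_fibre14_charge D lam' Ak φ z (fun x hx => hdm2d x hx e) (hE1d e)
  have hF_cont : ∀ e, Continuous (F e) := fun e =>
    continuous_fibre14₄ D e lam' continuous_const continuous_fst continuous_const continuous_snd
  have hF_meas : ∀ e, AEStronglyMeasurable (F e) (μ.prod volume) := fun e => (hF_cont e).aestronglyMeasurable
  have hreg : ∀ e ∈ I, 0 < lam' * D.lamRun ∨ ∀ x ∈ D.Ω₁, 0 < D.m2 + D.dm2 e lam' x :=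
    fun e he => Or.inr fun x hx => lt_of_lt_of_le hm₀ (hmass e he x hx)
  have hF_int : ∀ e ∈ I, Integrable (F e) (μ.prod volume) := fun e he =>
    (integral_integrand14_eq_integral_prod D hmsq ha hL hk hm2 hℓ hq (hreg e he) Ak φ).1
  have hZ : ∀ e ∈ I, ∫ A', D.integrand14 e lam' Ak φ A' ∂μ = ∫ z, F e z ∂(μ.prod volume) := fun e he =>
    (integral_integrand14_eq_integral_prod D hmsq ha hL hk hm2 hℓ hq (hreg e he) Ak φ).2
  obtain ⟨bound, hbound_int, hbound⟩ :=
    exists_chargeDeriv_majorant D hmsq ha hL hk hℓ hq hm₀ hm₀m hmass hdm2 hE1 Ak φ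
  have hF'_meas : AEStronglyMeasurable (F' e₀) (μ.prod volume) :=
    aestronglyMeasurable_of_hasDerivAt_param hF_meas fun z => hderiv z e₀
  have h_bound : ∀ᵐ z ∂(μ.prod volume), ∀ e ∈ I, ‖F' e z‖ ≤ bound z := by
    refine Filter.Eventually.of_forall fun z e he => ?_
    rw [Real.norm_eq_abs]
    change |(-chargeVertex D lam' Ak φ e z)
      * (D.kernel14 Ak e z.1 φ z.2 * D.density14 Ak e lam' z.1 (extendZero D.Ω z.2))| ≤ bound z
    rw [neg_mul, abs_neg]
    exact hbound e he z
  have hmain := (hasDerivAt_integral_of_dominated_loc_of_deriv_le hI_nhds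
    (Filter.Eventually.of_forall hF_meas) (hF_int e₀ he₀) hF'_meas h_bound hbound_int
    (Filter.Eventually.of_forall fun z e _ => hderiv z e)).2
  have hlim_eq : (-(∫ z, chargeVertex D lam' Ak φ e₀ z
        * (D.kernel14 Ak e₀ z.1 φ z.2 * D.density14 Ak e₀ lam' z.1 (extendZero D.Ω z.2)) ∂(μ.prod volume)))
      = ∫ z, F' e₀ z ∂(μ.prod volume) := by
    rw [← integral_neg]
    refine integral_congr_ae (Filter.Eventually.of_forall fun z => ?_)
    change -_ = (-chargeVertex D lam' Ak φ e₀ z)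
      * (D.kernel14 Ak e₀ z.1 φ z.2 * D.density14 Ak e₀ lam' z.1 (extendZero D.Ω z.2))
    rw [neg_mul]
  rw [hlim_eq]
  refine hmain.congr_of_eventuallyEq ?_
  filter_upwards [hI_nhds] with e he using hZ e he

/-- **`∂E_k/∂e′` EXISTS (two-sided) at every `e′₀` and equals the normalized expectation `⟨charge vertex⟩_{e′₀}`** of the
charge vertex in the `(e′₀, λ′)`-measure `Z⁻¹·t·exp[…]dμ(A′)dφ′↾_Ω` — the content of the `α`-derivatives of the printed
(1.5) to first order, for the typed instance. (ours) [cite: Balaban1983Higgs3, (1.4)–(1.5) p.412] -/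
theorem hasDerivAt_auxE_charge (hmsq : 0 < D.msq) (ha : 0 < D.a) (hL : 1 < (P.L : ℝ)) (hk1 : 1 ≤ k)
    (hk : k ≤ P.K) (hℓ : D.ell ≠ 0) {lam' : ℝ} (hq : 0 ≤ lam' * D.lamRun) {e₀ ρ m₀ : ℝ} (hρ : 0 < ρ) (hm₀ : 0 < m₀)
    (hm₀m : m₀ ≤ D.m2) (hmass : ∀ e ∈ Set.Icc (e₀ - ρ) (e₀ + ρ), ∀ x ∈ D.Ω₁, m₀ ≤ D.m2 + D.dm2 e lam' x)
    (hdm2 : ∀ x ∈ D.Ω₁, ContDiff ℝ 1 (fun e => D.dm2 e lam' x)) (hE1 : ContDiff ℝ 1 (fun e => D.E1 e lam'))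
    (Ak : HiggsLattice.VecField P 0) (φ : HiggsLattice.ScalarField P k N) :
    HasDerivAt (fun e => D.auxE e lam' Ak φ)
      ((∫ z, chargeVertex D lam' Ak φ e₀ z
          * (D.kernel14 Ak e₀ z.1 φ z.2 * D.density14 Ak e₀ lam' z.1 (extendZero D.Ω z.2))
          ∂((fluctFamily P D.msq D.a k).prod volume))
        / ∫ A', D.integrand14 e₀ lam' Ak φ A' ∂(fluctFamily P D.msq D.a k)) e₀ := by
  have hZ := hasDerivAt_integral_integrand14_charge D hmsq ha hL hk hℓ hq hρ hm₀ hm₀m hmass hdm2 hE1 Ak φ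
  have hm2 : 0 < D.m2 := lt_of_lt_of_le hm₀ hm₀m
  have hreg0 : 0 < lam' * D.lamRun ∨ ∀ x ∈ D.Ω₁, 0 < D.m2 + D.dm2 e₀ lam' x :=
    Or.inr fun x hx => lt_of_lt_of_le hm₀ (hmass e₀ ⟨by linarith, by linarith⟩ x hx)
  have hpos := integral_integrand14_pos D hmsq ha hL hk1 hk hm2 hℓ hq hreg0 Ak φ
  have hlog := (hZ.log hpos.ne').neg
  refine (hlog.congr_deriv ?_).congr_of_eventuallyEq (Filter.Eventually.of_forall fun e => rfl)
  rw [neg_div, neg_neg]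

/-- **THE REPAIRED INTERACTION (1.5) TO FIRST ORDER — BOTH TERMS GENUINE DERIVATIVES**:
`𝒫^{(k)}_{n̄=1}(Ω₁, A^{(k)}, φ) = ⟨charge vertex⟩₀ + ⟨λ′-vertex⟩₀`, the normalized expectations in the base-point
measure `Z₀⁻¹·t·exp[…]|_{e′=λ′=0}dμ(A′)dφ′↾_Ω` of the CHARGE vertex (`chargeVertex`: `∂_{e′}` of the exponent of
`t·exp[…]` — transports `U(e′g_kA′(Γ))` of the averages, covariant derivatives of `−Δ^η_{e′g_kA′+A^{(k)},Ω}`, and the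
`e′`-derivatives of the counterterms) and of the `λ′`-vertex (`B3Eq14Finite.lamVertex`: (1.6), (1.7) differentiated in
`λ′`) — `B3Eq14Finite.interaction15R_one_eq` with its two-sided `∂_{e′}E_k(·,0)|₀` now a PROVED derivative
(`hasDerivAt_auxE_charge`).  Hypotheses: H7 of `B3Eq14Finite` on the `λ′`-side at `e′ = 0`, and their mirror on the
`e′`-side at `λ′ = 0` (mass uniformly positive for `|e′| ≤ ρ`, data `C¹` in `e′`). (ours)
[cite: Balaban1983Higgs3, (1.5)–(1.7) pp.412–413] -/
theorem interaction15R_one_eq_expectations (hmsq : 0 < D.msq) (ha : 0 < D.a) (hL : 1 < (P.L : ℝ))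
    (hk1 : 1 ≤ k) (hk : k ≤ P.K) (hℓ : D.ell ≠ 0) (hrun : 0 ≤ D.lamRun) {δ ρ m₀ : ℝ} (hδ : 0 < δ) (hρ : 0 < ρ)
    (hm₀ : 0 < m₀) (hm₀m : m₀ ≤ D.m2) (hmass : ∀ s ∈ Set.Icc (0 : ℝ) δ, ∀ x ∈ D.Ω₁, m₀ ≤ D.m2 + D.dm2 0 s x)
    (hmass' : ∀ e ∈ Set.Icc (0 - ρ) (0 + ρ), ∀ x ∈ D.Ω₁, m₀ ≤ D.m2 + D.dm2 e 0 x)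
    (hdm2 : ∀ x ∈ D.Ω₁, ContDiff ℝ 1 (fun s => D.dm2 0 s x)) (hE1 : ContDiff ℝ 1 (fun s => D.E1 0 s))
    (hdm2' : ∀ x ∈ D.Ω₁, ContDiff ℝ 1 (fun e => D.dm2 e 0 x)) (hE1' : ContDiff ℝ 1 (fun e => D.E1 e 0))
    (Ak : HiggsLattice.VecField P 0) (φ : HiggsLattice.ScalarField P k N) :
    B3Eq15OneSidedInteraction.interaction15R D 1 Ak φ
      = (∫ z, chargeVertex D 0 Ak φ 0 z
            * (D.kernel14 Ak 0 z.1 φ z.2 * D.density14 Ak 0 0 z.1 (extendZero D.Ω z.2))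
            ∂((fluctFamily P D.msq D.a k).prod volume))
          / (∫ A', D.integrand14 0 0 Ak φ A' ∂(fluctFamily P D.msq D.a k))
        + (∫ z, lamVertex D 0 0 (extendZero D.Ω z.2)
            * (D.kernel14 Ak 0 z.1 φ z.2 * D.density14 Ak 0 0 z.1 (extendZero D.Ω z.2))
            ∂((fluctFamily P D.msq D.a k).prod volume))
          / ∫ A', D.integrand14 0 0 Ak φ A' ∂(fluctFamily P D.msq D.a k) := by
  rw [interaction15R_one_eq D hmsq ha hL hk1 hk hℓ hrun hδ hm₀ hm₀m hmass hdm2 hE1 Ak φ,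
    (hasDerivAt_auxE_charge D hmsq ha hL hk1 hk hℓ (by rw [zero_mul]) hρ hm₀ hm₀m hmass' hdm2' hE1' Ak φ).deriv]

end ChargeDerivative

end

end Literature.MathematicalPhysics.QuantumFieldTheory.Balaban1983to89.B3Eq15ChargeDerivative
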